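import Literature.MathematicalPhysics.QuantumFieldTheory.Sweep1
import Literature.MathematicalPhysics.QuantumFieldTheory.Sweep1AreaLawProofs
import Literature.Probability.LatticeModels.CharacterComplexRotationBound
import Literature.Probability.LatticeModels.DisorderedXYModel
import Literature.MathematicalPhysics.QuantumLattice.GaugeGroupsUnitaryProofs
import HarnessLib

/-!
# Confinement in three-dimensional lattice gauge theories with a central `U(1)` (Chatterjee 2026)

Named fact (topic `Literature/MathematicalPhysics/QuantumFieldTheory`; PROVED in Part II of this file,
`chatterjee_centralCircle_confinement_d3_holds`), in the
free-boundary `ℤ^d` vocabulary of `Sweep1` (`zdExpect ρ β Λ`, `zdWilsonLoop ρ x i j R T`,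
`rectangleSites`).

S. Chatterjee, *A short proof of confinement in three-dimensional lattice gauge theories with a
central `U(1)`*, arXiv:2602.00436 (2026), **Theorem 3.1** (p. 5 of the held text
`paper:arxiv-2602.00436`): «Let `G` be a compact Lie subgroup of `U(n)` for some `n`. Assume that
`zI ∈ G` for all `z ∈ ℂ` with `|z| = 1`. Let `Λ` be a finite subset of `ℤ³` and `β` be a positive
real number. Consider the lattice gauge theory on `Λ` with this `G` and `β`, under free boundary
condition. For any rectangular loop `ℓ` contained in `Λ` with side lengths `R ≤ T`, we have
`|⟨W_ℓ⟩| ≤ n e^{-C (1+nβ)^{-1} T log(R+1)}`, where `C` is a positive universal constant.» Here the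
Wilson action is `S_Λ(U) = ∑_{p ∈ P(Λ)} Re tr(I - U_p)` over the plaquettes with all four corners
in `Λ`, the a priori measure is product Haar measure, and `W_ℓ(U) = tr(U(x₀,x₁) ⋯ U(x_k,x₀))`
is the UN-normalised trace (§1 of the source) — whence the prefactor `n`; for the tree's
normalised loop `zdWilsonLoop = (1/n) Re tr` the bound reads `e^{-C T log(R+1)/(1+nβ)}`
(`|Re z| ≤ |z|`). This is confinement with a logarithmically growing static potential
`V(R) ≥ C log(R+1)/(1+nβ)` at EVERY `β > 0` in `d = 3`.

Context (source, §3): «Using an inequality of [Messager–Miracle-Solé–Pfister 1978], [Fröhlich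
1979] proved that `U(n)` lattice gauge theory confines whenever the corresponding `U(1)` theory
does. Earlier, [Glimm–Jaffe 1977] established confinement for three-dimensional `U(1)` gauge
theory with a logarithmically growing potential … Combining these results yields Theorem 3.1;
indeed it appears as Corollary 2 in [Fröhlich 1979].» The printed proof adapts the McBryan–Spencer
complex-rotation (Mermin–Wagner) argument: auxiliary `U(1)` edge variables (Haar invariance under
the central circle), conditioning on the `G`-part, factorisation over `T` slices, and a power-law
bound for a weighted two-dimensional XY-type two-point function (Lemma 3.3 / Cor. 3.4 of the source).
The companion file `CentreDominatedWilsonLoops.lean` PROVES the `ℤ₂`-centre version of Fröhlich's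
comparison on the torus and `CentralCircleDominatedWilsonLoops.lean` the `U(1)`-centre version. The
present theorem is PROVED below (`chatterjee_centralCircle_confinement_d3_holds`, second part of this
file) with the universal constant `C = 1/1890`: the expanded model of the source's §4 (auxiliary
`U(1)` bond variables, Haar invariance under the central circle, Fubini) combined — in place of the
source's Lemmas 4.1–4.3 (anti-concentration and conditioning) — with the original Glimm–Jaffe 1977 /
McBryan–Spencer complex rotation of the auxiliary variables (the tree's
`Literature.Probability.LatticeModels.abs_integral_reMulChar_mul_complexGinibreWeight_le`,
`CharacterComplexRotationBound.lean`) along the truncated logarithmic rotation field of the loop,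
whose cost over the `T` slices is `O(T δ² log R)` by counting two-dimensional shells; this is the
route of [GlimmJaffe1977QuarkTrapping] which the source streamlines.

HONEST FRAMING: `d = 3` only; logarithmic (not linear) confinement; nothing about `d = 4`, the
mass gap or the continuum limit.

## References

* S. Chatterjee, arXiv:2602.00436 (2026), Thm 3.1, §§1–3. [Chatterjee2026CentralU1]
* J. Fröhlich, Phys. Lett. 83B (1979) 195, Cor. 2 (as reported by the source). [Frohlich1979ZN]
* J. Glimm, A. Jaffe, *Quark trapping for lattice U(1) gauge fields*, Phys. Lett. 66B (1977) 67–69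
  (the complex-rotation proof of logarithmic confinement for `U(1)₃`). [GlimmJaffe1977QuarkTrapping]
* O. A. McBryan, T. Spencer, Comm. Math. Phys. 53 (1977) 299–302. [McBryanSpencer1977]
-/

noncomputable section

open MeasureTheory

namespace Literature.MathematicalPhysics.QuantumFieldTheory

/-- **Chatterjee 2026, Theorem 3.1** (confinement with a logarithmic potential for
three-dimensional Wilson lattice gauge theories whose gauge group contains the central circle).
There is a universal constant `C > 0` such that: for every `n ≥ 1`, every compact group `G` with a
continuous faithful unitary representation `ρ` on `ℂⁿ` whose image contains every scalar `z·I`,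
`|z| = 1` (i.e. `G` is a compact subgroup of `U(n)` containing the central `U(1)`), every `β > 0`,
every finite `Λ ⊆ ℤ³` (free boundary conditions, `zdExpect`) and every rectangular loop in `Λ`
with side lengths `1 ≤ R ≤ T` (in any coordinate plane `i ≠ j`),
`|⟨(1/n) Re tr U_{∂R×T}⟩_{Λ,β}| ≤ exp(-C · T · log(R+1) / (1 + nβ))`
(the printed bound `n e^{-C(1+nβ)^{-1} T log(R+1)}` for the un-normalised trace, divided by `n`).
[cite: Chatterjee2026CentralU1, Thm 3.1] -/
def chatterjee_centralCircle_confinement_d3 : Prop :=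
  ∃ C : ℝ, 0 < C ∧
    ∀ (n : ℕ), 1 ≤ n → ∀ (G : Type) [Group G] [TopologicalSpace G] [IsTopologicalGroup G]
      [CompactSpace G] [MeasurableSpace G] [BorelSpace G] (ρ : G →* Matrix (Fin n) (Fin n) ℂ),
      Continuous ρ → Function.Injective ρ →
      Set.range ρ ⊆ (Matrix.unitaryGroup (Fin n) ℂ : Set (Matrix (Fin n) (Fin n) ℂ)) →
      (∀ z : ℂ, ‖z‖ = 1 → z • (1 : Matrix (Fin n) (Fin n) ℂ) ∈ Set.range ρ) →
      ∀ (β : ℝ), 0 < β →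
        ∀ (Λ : Finset (Literature.Probability.LatticeModels.Site 3))
          (x : Literature.Probability.LatticeModels.Site 3) (i j : Fin 3) (R T : ℕ),
          i ≠ j → 1 ≤ R → R ≤ T → rectangleSites x i j R T ⊆ Λ →
            |zdExpect ρ β Λ (zdWilsonLoop ρ x i j R T)| ≤
              Real.exp (-C * T * Real.log (R + 1) / (1 + n * β))

/-- The printed form of the conclusion of `chatterjee_centralCircle_confinement_d3` exhibits
confinement: the static-potential lower bound `V(R) = C log(R+1)/(1+nβ) → ∞` as `R → ∞`, for
every fixed `n` and `β` (source §2: «the theory confines if there exists `V(R) → ∞` with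
`⟨W_ℓ⟩ ≤ C e^{-V(R)T}`»). [cite: Chatterjee2026CentralU1, §2 and Thm 3.1] -/
theorem tendsto_log_potential_atTop {C : ℝ} (hC : 0 < C) (n : ℕ) {β : ℝ} (hβ : 0 < β) :
    Filter.Tendsto (fun R : ℕ => C * Real.log (R + 1) / (1 + n * β)) Filter.atTop Filter.atTop := by
  have hden : 0 < 1 + (n : ℝ) * β := by positivity
  have h1 : Filter.Tendsto (fun R : ℕ => Real.log ((R : ℝ) + 1)) Filter.atTop Filter.atTop :=
    Real.tendsto_log_atTop.comp
      (tendsto_natCast_atTop_atTop.atTop_add tendsto_const_nhds)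
  have h2 := h1.const_mul_atTop hC
  simpa [div_eq_mul_inv, mul_comm, mul_left_comm, mul_assoc] using h2.atTop_mul_const (inv_pos.2 hden)

end Literature.MathematicalPhysics.QuantumFieldTheory

end

/-!
## Part II — Proof of Theorem 3.1 (`chatterjee_centralCircle_confinement_d3_holds`)

Architecture (namespace `CentralCircle`):

* **A. Central circle.** From the hypotheses of the fact (faithful continuous unitary `ρ` whose image
  contains the scalars) the continuous central homomorphism `ι : U(1) → G` with `ρ(ι w) = w·1`
  (`centralCircleHom`, `continuous_centralCircleHom`; `ρ` is a closed embedding of the compact `G`).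
* **B. Expanded model, algebra.** Holonomies are functorial under bondwise homomorphisms
  (`line_map`, `plaquette_map`, `rectangle_map`), so multiplying the bond variables by central
  elements `ι(χ_e)` multiplies plaquettes and Wilson loops by `ι` of the abelian holonomy of `χ`
  (`plaquette_central_mul`, `rectangle_central_mul`; Chatterjee §4: `Re Tr(χ_p U_p)`, `χ_ℓ Q_ℓ`).
* **C. Auxiliary torus.** `U(1)` variables on the bonds based in `Λ` (`bondsOf`, `extConfig`), their
  plaquette and loop characters (`plaqChar`, `loopChar`), and the exponential configurations
  `e^{iτa}` whose holonomies are `e^{iτ(da)_p}`, `e^{iτ a(ℓ)}` (`plaqChar_expField`, `loopChar_expField`).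
* **D. The Glimm–Jaffe rotation field** `pot` of an `R × T` loop: `δ(log(R+1) − log(min(d,R)+1))` on
  the `j`-bonds of the `T` slices, `d` the transverse sup-distance to the forward `j`-side; its gain
  `a(ℓ) = Tδ log(R+1)` (`rectSum_pot`) and its cost `∑_{p ∈ P(Λ)} (cosh (d pot)_p − 1) ≤
  189 T δ² (1 + log(R+1))` uniformly in `Λ` (`sum_cosh_plaqSum_pot_sub_one_le`, by the shell bound
  `shellSum_le`: `∑_{‖v‖∞ ≤ R} 1/max(1,‖v‖∞)² ≤ 21(1 + log(R+1))` in `ℤ²`).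
* **E. Assembly.** `dg_∞` is invariant under bondwise left multiplication
  (`integral_zdHaar_comp_mul_left`), hence `∫ F dU = ∫∫ F(ι(χ)U) dχ dU` (Fubini,
  `integral_eq_integral_integral_twistCfg`); at fixed `U` the `χ`-integral is a complex-coupling
  abelian Gibbs integral with couplings `K_p = β tr ρ(U_p)`, `‖K_p‖ ≤ nβ` (`weight_twistCfg`), to
  which the McBryan–Spencer bound of `CharacterComplexRotationBound.lean` applies
  (`abs_integral_twistCfg_le`), giving `|⟨W⟩| ≤ exp(−Tδ log(R+1) + nβ·189Tδ²(1+log(R+1)))`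
  (`abs_zdExpect_wilsonLoop_le_exp`); **F.** `δ = min(1, 1/(945 nβ))` yields `C = 1/1890`.

HONEST FRAMING (cell ym-ir): a `d = 3` logarithmic-confinement theorem for groups with a central
circle (e.g. `U(N)`), all `β`; it says nothing about `SU(N)`, `d = 4`, the mass gap or the continuum
limit; the YM mass gap (Clay) is NOT proved by any of this.
-/

noncomputable section

open MeasureTheory Finset Filter
open scoped BigOperators ComplexConjugate

namespace Literature.MathematicalPhysics.QuantumFieldTheory

open Literature.Probability.LatticeModels (torusHaar expField complexGinibreWeight
  complexHamiltonian coordChar)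

namespace CentralCircle

/-! ### A. The central circle of the gauge group -/

section Hom

variable {n : ℕ} {G : Type*} [Group G] (ρ : G →* Matrix (Fin n) (Fin n) ℂ)

/-- Scalar unitary matrices multiply: `(a • 1)(b • 1) = (ab) • 1`. [folklore] -/
private theorem smul_one_mul_smul_one (a b : ℂ) :
    (a • (1 : Matrix (Fin n) (Fin n) ℂ)) * (b • (1 : Matrix (Fin n) (Fin n) ℂ)) =
      (a * b) • (1 : Matrix (Fin n) (Fin n) ℂ) := by
  rw [smul_mul_assoc, one_mul, smul_smul]

/-- The central circle `U(1) → G`, `w ↦ ρ⁻¹(w · 1)`, of a faithful matrix model whose image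
contains the scalars (Chatterjee 2026 §3: `{zI : |z| = 1} ⊆ G`). [cite: Chatterjee2026CentralU1, §3 (hypothesis of Thm 3.1)] -/
def centralCircleHom (hinj : Function.Injective ρ)
    (hsc : ∀ z : ℂ, ‖z‖ = 1 → z • (1 : Matrix (Fin n) (Fin n) ℂ) ∈ Set.range ρ) : Circle →* G where
  toFun w := (Set.mem_range.1 (hsc (w : ℂ) (Circle.norm_coe w))).choose
  map_one' := hinj (by
    rw [(Set.mem_range.1 (hsc ((1 : Circle) : ℂ) (Circle.norm_coe 1))).choose_spec, map_one,
      Circle.coe_one, one_smul])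
  map_mul' w w' := hinj (by
    rw [(Set.mem_range.1 (hsc ((w * w' : Circle) : ℂ) (Circle.norm_coe _))).choose_spec, map_mul,
      (Set.mem_range.1 (hsc (w : ℂ) (Circle.norm_coe w))).choose_spec,
      (Set.mem_range.1 (hsc (w' : ℂ) (Circle.norm_coe w'))).choose_spec, Circle.coe_mul,
      smul_one_mul_smul_one])

/-- `ρ(ι(w)) = w · 1`. [cite: Chatterjee2026CentralU1, §3 (hypothesis of Thm 3.1)] -/
theorem rho_centralCircleHom (hinj : Function.Injective ρ)
    (hsc : ∀ z : ℂ, ‖z‖ = 1 → z • (1 : Matrix (Fin n) (Fin n) ℂ) ∈ Set.range ρ) (w : Circle) :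
    ρ (centralCircleHom ρ hinj hsc w) = (w : ℂ) • (1 : Matrix (Fin n) (Fin n) ℂ) :=
  (Set.mem_range.1 (hsc (w : ℂ) (Circle.norm_coe w))).choose_spec

/-- The central circle is central: `ι(w) g = g ι(w)`. [cite: Chatterjee2026CentralU1, §3 (hypothesis of Thm 3.1)] -/
theorem centralCircleHom_comm (hinj : Function.Injective ρ)
    (hsc : ∀ z : ℂ, ‖z‖ = 1 → z • (1 : Matrix (Fin n) (Fin n) ℂ) ∈ Set.range ρ) (w : Circle) (g : G) :
    centralCircleHom ρ hinj hsc w * g = g * centralCircleHom ρ hinj hsc w :=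
  hinj (by rw [map_mul, map_mul, rho_centralCircleHom, smul_mul_assoc, one_mul, Matrix.mul_smul,
    mul_one])

/-- `ρ(ι(w) g) = w · ρ(g)`. [cite: Chatterjee2026CentralU1, §4 (expanded model, `χ_p U_p`)] -/
theorem rho_centralCircleHom_mul (hinj : Function.Injective ρ)
    (hsc : ∀ z : ℂ, ‖z‖ = 1 → z • (1 : Matrix (Fin n) (Fin n) ℂ) ∈ Set.range ρ) (w : Circle) (g : G) :
    ρ (centralCircleHom ρ hinj hsc w * g) = (w : ℂ) • ρ g := by
  rw [map_mul, rho_centralCircleHom, smul_mul_assoc, one_mul]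

/-- `ρ(ι(w) g) = w · ρ(g)` when `ρ ∘ ι` is the scalar embedding. [cite: Chatterjee2026CentralU1, §4 (expanded model, `χ_p U_p`)] -/
theorem rho_mul_of_scalar {ι : Circle →* G} (hρι : ∀ w : Circle, ρ (ι w) = (w : ℂ) • (1 : Matrix (Fin n) (Fin n) ℂ))
    (w : Circle) (g : G) : ρ (ι w * g) = (w : ℂ) • ρ g := by
  rw [map_mul, hρι, smul_mul_assoc, one_mul]

variable [TopologicalSpace G] [CompactSpace G]

/-- A faithful continuous matrix model of a compact group is a closed embedding. [folklore] -/
private theorem isClosedEmbedding_rho (hinj : Function.Injective ρ) (hρc : Continuous ρ) : Topology.IsClosedEmbedding ρ := by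
  haveI : T2Space (Matrix (Fin n) (Fin n) ℂ) := show T2Space (Fin n → Fin n → ℂ) from inferInstance
  exact hρc.isClosedEmbedding hinj

/-- The central circle is continuous (ρ is a closed embedding of the compact group and
`w ↦ w · 1` is continuous). [cite: Chatterjee2026CentralU1, §3 (hypothesis of Thm 3.1)] -/
theorem continuous_centralCircleHom (hinj : Function.Injective ρ)
    (hsc : ∀ z : ℂ, ‖z‖ = 1 → z • (1 : Matrix (Fin n) (Fin n) ℂ) ∈ Set.range ρ) (hρc : Continuous ρ) :
    Continuous (centralCircleHom ρ hinj hsc) := by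
  rw [(isClosedEmbedding_rho ρ hinj hρc).isEmbedding.isInducing.continuous_iff]
  have h : (ρ ∘ centralCircleHom ρ hinj hsc) = fun w : Circle => (w : ℂ) • (1 : Matrix (Fin n) (Fin n) ℂ) :=
    funext fun w => rho_centralCircleHom ρ hinj hsc w
  rw [h]
  exact continuous_subtype_val.smul continuous_const

/-- A compact group with a faithful continuous matrix model is second countable. [cite: Chatterjee2026CentralU1, §1 (compact Lie subgroup of U(n))] -/
theorem secondCountableTopology_of_model (hinj : Function.Injective ρ) (hρc : Continuous ρ) : SecondCountableTopology G := by
  haveI : SecondCountableTopology (Matrix (Fin n) (Fin n) ℂ) :=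
    show SecondCountableTopology (Fin n → Fin n → ℂ) from inferInstance
  exact (isClosedEmbedding_rho ρ hinj hρc).isEmbedding.secondCountableTopology

end Hom

/-! ### B. Holonomies are functorial; central multiplication factors out -/

section Functorial

variable {d : ℕ} {H G : Type*} [Group H] [Group G]

/-- Straight-line holonomies commute with homomorphisms applied bondwise. [cite: Chatterjee2026CentralU1, §4 (expanded model)] -/
theorem line_map (φ : H →* G) (V : ZdGaugeConfig d H) (k : Fin d) (m : ℕ) (y : Literature.Probability.LatticeModels.Site d) :
    ZdGaugeConfig.line (fun e => φ (V e)) k m y = φ (V.line k m y) := by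
  induction m generalizing y with
  | zero => simp [ZdGaugeConfig.line]
  | succ m ih => simp [ZdGaugeConfig.line, ih, map_mul]

/-- Plaquette holonomies commute with homomorphisms applied bondwise. [cite: Chatterjee2026CentralU1, §4 (expanded model)] -/
theorem plaquette_map (φ : H →* G) (V : ZdGaugeConfig d H) (x : Literature.Probability.LatticeModels.Site d) (i j : Fin d) :
    ZdGaugeConfig.plaquette (fun e => φ (V e)) x i j = φ (V.plaquette x i j) := by
  simp [ZdGaugeConfig.plaquette, map_mul, map_inv]

/-- Rectangular holonomies commute with homomorphisms applied bondwise. [cite: Chatterjee2026CentralU1, §4 (expanded model)] -/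
theorem rectangle_map (φ : H →* G) (V : ZdGaugeConfig d H) (x : Literature.Probability.LatticeModels.Site d) (i j : Fin d) (R T : ℕ) :
    ZdGaugeConfig.rectangle (fun e => φ (V e)) x i j R T = φ (V.rectangle x i j R T) := by
  simp [ZdGaugeConfig.rectangle, line_map, map_mul, map_inv]

variable {A : Type*} [Group A]

/-- `(w, g) ↦ ι(w) g` is a homomorphism `A × G → G` when `ι(A)` is central (the structure map of
the expanded model `(χ, U) ↦ χU`). [cite: Chatterjee2026CentralU1, §4 (expanded model, `χU`)] -/
def centralMulHom (ι : A →* G) (hι : ∀ w g, ι w * g = g * ι w) : A × G →* G where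
  toFun p := ι p.1 * p.2
  map_one' := by simp
  map_mul' p q := by
    simp only [Prod.fst_mul, Prod.snd_mul, map_mul]
    rw [mul_assoc, mul_assoc, ← mul_assoc (ι q.1) p.2 q.2, hι q.1 p.2, mul_assoc]

/-- Components of the holonomy of a paired configuration. [folklore] -/
private theorem rectangle_pair (z : ZdGaugeConfig d A) (U : ZdGaugeConfig d G) (x : Literature.Probability.LatticeModels.Site d)
    (i j : Fin d) (R T : ℕ) :
    ZdGaugeConfig.rectangle (fun e => (z e, U e)) x i j R T =
      (z.rectangle x i j R T, U.rectangle x i j R T) := by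
  refine Prod.ext ?_ ?_
  · exact (rectangle_map (MonoidHom.fst A G) (fun e => (z e, U e)) x i j R T).symm
  · exact (rectangle_map (MonoidHom.snd A G) (fun e => (z e, U e)) x i j R T).symm

/-- Components of the plaquette of a paired configuration. [folklore] -/
private theorem plaquette_pair (z : ZdGaugeConfig d A) (U : ZdGaugeConfig d G) (x : Literature.Probability.LatticeModels.Site d)
    (i j : Fin d) :
    ZdGaugeConfig.plaquette (fun e => (z e, U e)) x i j = (z.plaquette x i j, U.plaquette x i j) := by
  refine Prod.ext ?_ ?_
  · exact (plaquette_map (MonoidHom.fst A G) (fun e => (z e, U e)) x i j).symm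
  · exact (plaquette_map (MonoidHom.snd A G) (fun e => (z e, U e)) x i j).symm

/-- **Central factors come out of Wilson loops**: multiplying every bond variable by a central
element `ι(z_e)` multiplies the rectangular holonomy by `ι` of the abelian holonomy of `z`
(Chatterjee 2026 §4: `W_ℓ(χU) = χ_ℓ · tr(U(e₁)⋯U(e_k))`). [cite: Chatterjee2026CentralU1, §4 (proof of Thm 3.1: `E(W_ℓ) = E(χ_ℓ Q_ℓ)`)] -/
theorem rectangle_central_mul (ι : A →* G) (hι : ∀ w g, ι w * g = g * ι w)
    (z : ZdGaugeConfig d A) (U : ZdGaugeConfig d G) (x : Literature.Probability.LatticeModels.Site d) (i j : Fin d) (R T : ℕ) :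
    ZdGaugeConfig.rectangle (fun e => ι (z e) * U e) x i j R T =
      ι (z.rectangle x i j R T) * U.rectangle x i j R T := by
  have h := rectangle_map (centralMulHom ι hι) (fun e => (z e, U e)) x i j R T
  rw [rectangle_pair] at h
  exact h

/-- Central factors come out of plaquettes: `(χU)_p = ι(χ_p) U_p`. [cite: Chatterjee2026CentralU1, §4 (expanded model, `χ_p U_p`)] -/
theorem plaquette_central_mul (ι : A →* G) (hι : ∀ w g, ι w * g = g * ι w)
    (z : ZdGaugeConfig d A) (U : ZdGaugeConfig d G) (x : Literature.Probability.LatticeModels.Site d) (i j : Fin d) :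
    ZdGaugeConfig.plaquette (fun e => ι (z e) * U e) x i j = ι (z.plaquette x i j) * U.plaquette x i j := by
  have h := plaquette_map (centralMulHom ι hι) (fun e => (z e, U e)) x i j
  rw [plaquette_pair] at h
  exact h

end Functorial

/-! ### C. Auxiliary `U(1)` bond variables on a finite set of bonds, their characters, and
exponential configurations -/

section Torus

variable {d : ℕ} (S : Finset (ZdEdge d))

/-- Extension by `1` of a `U(1)` configuration on the bonds of `S` to all bonds. [cite: Chatterjee2026CentralU1, §4 (expanded model: auxiliary `U(1)` edge variables)] -/
def extConfig (z : ↥S → Circle) : ZdGaugeConfig d Circle :=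
  fun e => if h : e ∈ S then z ⟨e, h⟩ else 1

/-- Extension by `0` of a real potential on the bonds of `S`. [cite: GlimmJaffe1977QuarkTrapping, main estimate (the rotation field)] -/
def extPot (a : ↥S → ℝ) : ZdEdge d → ℝ :=
  fun e => if h : e ∈ S then a ⟨e, h⟩ else 0

/-- On the bonds of `S` the extension is the given configuration. [folklore] -/
private theorem extConfig_apply_of_mem (z : ↥S → Circle) {e : ZdEdge d} (h : e ∈ S) :
    extConfig S z e = z ⟨e, h⟩ := dif_pos h

/-- On the bonds of `S` the extended potential is the given potential. [folklore] -/
private theorem extPot_apply_of_mem (a : ↥S → ℝ) {e : ZdEdge d} (h : e ∈ S) :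
    extPot S a e = a ⟨e, h⟩ := dif_pos h

/-- Extension is multiplicative. [folklore] -/
private theorem extConfig_mul (z z' : ↥S → Circle) : extConfig S (z * z') = extConfig S z * extConfig S z' := by
  funext e
  by_cases h : e ∈ S <;> simp [extConfig, h]

/-- Extension is continuous. [folklore] -/
private theorem continuous_extConfig : Continuous (extConfig (d := d) S) := by
  refine continuous_pi fun e => ?_
  by_cases h : e ∈ S
  · simp only [extConfig, h, dif_pos]; exact continuous_apply _
  · simp only [extConfig, h, dif_neg, not_false_eq_true]; exact continuous_const

/-- The extension of the rotated configuration `(e^{iτ aₛ})ₛ` is `(e^{iτ ã_e})_e`, `ã` the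
extension by zero. [cite: GlimmJaffe1977QuarkTrapping, main estimate (the rotation field)] -/
theorem extConfig_expField (a : ↥S → ℝ) (τ : ℝ) :
    extConfig S (expField a τ) = fun e => Circle.exp (τ * extPot S a e) := by
  funext e
  by_cases h : e ∈ S
  · simp [extConfig, extPot, h]
  · simp [extConfig, extPot, h]

variable {A : Type*} [CommGroup A]

/-- In an abelian group the rectangular holonomy is multiplicative in the configuration. [folklore] -/
private theorem rectangle_mul (z z' : ZdGaugeConfig d A) (x : Literature.Probability.LatticeModels.Site d) (i j : Fin d) (R T : ℕ) :
    ZdGaugeConfig.rectangle (z * z') x i j R T = z.rectangle x i j R T * z'.rectangle x i j R T := by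
  have h := rectangle_central_mul (MonoidHom.id A) (fun w g => mul_comm w g) z z' x i j R T
  exact h

/-- In an abelian group the plaquette holonomy is multiplicative in the configuration. [folklore] -/
private theorem plaquette_mul (z z' : ZdGaugeConfig d A) (x : Literature.Probability.LatticeModels.Site d) (i j : Fin d) :
    ZdGaugeConfig.plaquette (z * z') x i j = z.plaquette x i j * z'.plaquette x i j := by
  have h := plaquette_central_mul (MonoidHom.id A) (fun w g => mul_comm w g) z z' x i j
  exact h

variable [TopologicalSpace A] [IsTopologicalGroup A]

/-- The plaquette character `z ↦ (ext z)_p` of the auxiliary torus `U(1)^S`. [cite: Chatterjee2026CentralU1, §4 (expanded model, `χ_p`)] -/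
def plaqChar (x : Literature.Probability.LatticeModels.Site d) (i j : Fin d) : (↥S → Circle) →ₜ* Circle where
  toFun z := (extConfig S z).plaquette x i j
  map_one' := by
    have : extConfig S (1 : ↥S → Circle) = 1 := by funext e; by_cases h : e ∈ S <;> simp [extConfig, h]
    rw [this]; simp [ZdGaugeConfig.plaquette]
  map_mul' z z' := by rw [extConfig_mul, plaquette_mul]
  continuous_toFun := (AreaLaw.continuous_plaquette x i j).comp (continuous_extConfig S)

/-- The loop character `z ↦ (ext z)_ℓ` of the auxiliary torus. [cite: Chatterjee2026CentralU1, §4 (expanded model, `χ_ℓ`)] -/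
def loopChar (x : Literature.Probability.LatticeModels.Site d) (i j : Fin d) (R T : ℕ) : (↥S → Circle) →ₜ* Circle where
  toFun z := (extConfig S z).rectangle x i j R T
  map_one' := by
    have : extConfig S (1 : ↥S → Circle) = 1 := by funext e; by_cases h : e ∈ S <;> simp [extConfig, h]
    rw [this]
    have h1 := rectangle_map (1 : Circle →* Circle) (fun _ => (1 : Circle)) x i j R T
    simp only [MonoidHom.one_apply] at h1
    exact h1
  map_mul' z z' := by rw [extConfig_mul, rectangle_mul]
  continuous_toFun := (AreaLaw.continuous_rectangle x i j R T).comp (continuous_extConfig S)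

/-- The plaquette character, unfolded. [folklore] -/
@[simp] private theorem plaqChar_apply (x : Literature.Probability.LatticeModels.Site d) (i j : Fin d) (z : ↥S → Circle) :
    plaqChar S x i j z = (extConfig S z).plaquette x i j := rfl

/-- The loop character, unfolded. [folklore] -/
@[simp] private theorem loopChar_apply (x : Literature.Probability.LatticeModels.Site d) (i j : Fin d) (R T : ℕ) (z : ↥S → Circle) :
    loopChar S x i j R T z = (extConfig S z).rectangle x i j R T := rfl

/-! #### Exponential configurations: holonomies of `e^{iτ a}` are exponentials of sums -/

/-- The sum of a real bond function along a straight path. [cite: GlimmJaffe1977QuarkTrapping, main estimate (the rotation field)] -/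
def lineSum (a : ZdEdge d → ℝ) (k : Fin d) : ℕ → Literature.Probability.LatticeModels.Site d → ℝ
  | 0, _ => 0
  | m + 1, y => a (y, k) + lineSum a k m (y + Pi.single k 1)

/-- The oriented sum of a real bond function around a plaquette (its lattice curl). [cite: GlimmJaffe1977QuarkTrapping, main estimate (`(da)_p`)] -/
def plaqSum (a : ZdEdge d → ℝ) (x : Literature.Probability.LatticeModels.Site d) (i j : Fin d) : ℝ :=
  a (x, i) + a (x + Pi.single i 1, j) - a (x + Pi.single j 1, i) - a (x, j)

/-- The oriented sum of a real bond function around the rectangular loop. [cite: GlimmJaffe1977QuarkTrapping, main estimate (`a(ℓ)`)] -/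
def rectSum (a : ZdEdge d → ℝ) (x : Literature.Probability.LatticeModels.Site d) (i j : Fin d) (R T : ℕ) : ℝ :=
  lineSum a i R x + lineSum a j T (x + Pi.single i (R : ℤ)) -
    lineSum a i R (x + Pi.single j (T : ℤ)) - lineSum a j T x

/-- The straight-line holonomy of `e^{iτa}` is `e^{iτ Σ a}`. [folklore] -/
private theorem line_exp (a : ZdEdge d → ℝ) (τ : ℝ) (k : Fin d) (m : ℕ) (y : Literature.Probability.LatticeModels.Site d) :
    ZdGaugeConfig.line (fun e => Circle.exp (τ * a e)) k m y = Circle.exp (τ * lineSum a k m y) := by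
  induction m generalizing y with
  | zero => simp [ZdGaugeConfig.line, lineSum]
  | succ m ih => rw [ZdGaugeConfig.line, ih, lineSum, mul_add, Circle.exp_add]

/-- The plaquette holonomy of `e^{iτa}` is `e^{iτ(da)_p}`. [folklore] -/
private theorem plaquette_exp (a : ZdEdge d → ℝ) (τ : ℝ) (x : Literature.Probability.LatticeModels.Site d) (i j : Fin d) :
    ZdGaugeConfig.plaquette (fun e => Circle.exp (τ * a e)) x i j = Circle.exp (τ * plaqSum a x i j) := by
  simp only [ZdGaugeConfig.plaquette, plaqSum, mul_add, mul_sub, Circle.exp_add, Circle.exp_sub,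
    div_eq_mul_inv]

/-- The rectangular holonomy of `e^{iτa}` is `e^{iτ a(ℓ)}`. [folklore] -/
private theorem rectangle_exp (a : ZdEdge d → ℝ) (τ : ℝ) (x : Literature.Probability.LatticeModels.Site d) (i j : Fin d) (R T : ℕ) :
    ZdGaugeConfig.rectangle (fun e => Circle.exp (τ * a e)) x i j R T =
      Circle.exp (τ * rectSum a x i j R T) := by
  simp only [ZdGaugeConfig.rectangle, line_exp, rectSum, mul_add, mul_sub, Circle.exp_add,
    Circle.exp_sub, div_eq_mul_inv]

/-- Along the rotation `expField a` the plaquette character is the exponential of the curl of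
the extended potential. [cite: GlimmJaffe1977QuarkTrapping, main estimate (`θ_p ↦ θ_p + i(da)_p`)] -/
theorem plaqChar_expField (a : ↥S → ℝ) (x : Literature.Probability.LatticeModels.Site d) (i j : Fin d) (τ : ℝ) :
    plaqChar S x i j (expField a τ) = Circle.exp (τ * plaqSum (extPot S a) x i j) := by
  rw [plaqChar_apply, extConfig_expField, plaquette_exp]

/-- Along the rotation `expField a` the loop character is the exponential of the loop sum of
the extended potential. [cite: GlimmJaffe1977QuarkTrapping, main estimate (`W(C) ↦ e^{-a(C)} W(C)`)] -/
theorem loopChar_expField (a : ↥S → ℝ) (x : Literature.Probability.LatticeModels.Site d) (i j : Fin d) (R T : ℕ) (τ : ℝ) :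
    loopChar S x i j R T (expField a τ) = Circle.exp (τ * rectSum (extPot S a) x i j R T) := by
  rw [loopChar_apply, extConfig_expField, rectangle_exp]

/-! #### Sums of bond functions that agree on the relevant bonds -/

/-- Line sums of bond functions agreeing along the path agree. [folklore] -/
private theorem lineSum_congr {a b : ZdEdge d → ℝ} {k : Fin d} {m : ℕ} {y : Literature.Probability.LatticeModels.Site d}
    (h : ∀ t : ℕ, t < m → a (y + Pi.single k (t : ℤ), k) = b (y + Pi.single k (t : ℤ), k)) :
    lineSum a k m y = lineSum b k m y := by
  induction m generalizing y with
  | zero => rfl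
  | succ m ih =>
    simp only [lineSum]
    have h0 := h 0 (Nat.succ_pos m)
    simp only [Nat.cast_zero, Pi.single_zero, add_zero] at h0
    rw [h0, ih fun t ht => ?_]
    have := h (t + 1) (Nat.succ_lt_succ ht)
    rwa [AreaLaw.site_shift] 

end Torus


/-! ### D. The Glimm–Jaffe rotation field of an `R × T` loop in three dimensions -/

section Potential

open Literature.Probability.LatticeModels (box sphere mem_sphere mem_box_iff_supNorm_le card_box
  card_sphere_succ_le sphere_subset_box)

/-- `lineSum` of a bond function vanishing along the path is zero. [folklore] -/
private theorem lineSum_eq_mul_of_forall {d : ℕ} {a : ZdEdge d → ℝ} {k : Fin d} {m : ℕ}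
    {y : Literature.Probability.LatticeModels.Site d} {c : ℝ}
    (h : ∀ t : ℕ, t < m → a (y + Pi.single k (t : ℤ), k) = c) :
    lineSum a k m y = m * c := by
  induction m generalizing y with
  | zero => simp [lineSum]
  | succ m ih =>
    simp only [lineSum]
    have h0 := h 0 (Nat.succ_pos m)
    simp only [Nat.cast_zero, Pi.single_zero, add_zero] at h0
    rw [h0, ih fun t ht => ?_]
    · push_cast; ring
    · have := h (t + 1) (Nat.succ_lt_succ ht)
      rwa [AreaLaw.site_shift]

variable (x : Literature.Probability.LatticeModels.Site 3) (i j : Fin 3) (R T : ℕ) (δ : ℝ)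

/-- The base point `x' = x + R eᵢ` of the forward `j`-side of the loop. [cite: Chatterjee2026CentralU1, §4 (proof of Thm 3.1: the edges `q_j`)] -/
def fwdBase : Literature.Probability.LatticeModels.Site 3 := x + Pi.single i (R : ℤ)

/-- The transverse part of a lattice vector: its two coordinates other than the `j`-th. [cite: Chatterjee2026CentralU1, §4 (proof of Thm 3.1: the 2D slices)] -/
def transverse (w : Literature.Probability.LatticeModels.Site 3) : Literature.Probability.LatticeModels.Site 2 :=
  Fin.removeNth j w

/-- The transverse sup-distance of a site to the forward `j`-side of the loop. [cite: GlimmJaffe1977QuarkTrapping, main estimate (distance to the current line)] -/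
def tdist (y : Literature.Probability.LatticeModels.Site 3) : ℕ :=
  Literature.Probability.LatticeModels.Site.supNorm (transverse j (y - fwdBase x i R))

/-- The truncated logarithmic potential `δ (log(R+1) − log(min(m,R)+1))`. [cite: GlimmJaffe1977QuarkTrapping, main estimate (logarithmic rotation field)] -/
def logPot (δ : ℝ) (R m : ℕ) : ℝ := δ * (Real.log (R + 1) - Real.log (min m R + 1))

/-- The Glimm–Jaffe rotation field of the loop: on the `j`-bonds at heights `0 ≤ y_j − x_j < T` the
truncated logarithmic potential of the transverse distance to the forward `j`-side, zero on all other
bonds. [cite: GlimmJaffe1977QuarkTrapping, main estimate (logarithmic rotation field)] -/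
def pot : ZdEdge 3 → ℝ := fun e =>
  if e.2 = j ∧ 0 ≤ e.1 j - x j ∧ e.1 j - x j < T then logPot δ R (tdist x i j R e.1) else 0

/-- The site cost majorising `cosh((d pot)_p) − 1` for the plaquettes based at `y`. [cite: GlimmJaffe1977QuarkTrapping, main estimate (energy of the rotation field)] -/
def siteCost (y : Literature.Probability.LatticeModels.Site 3) : ℝ :=
  if (0 ≤ y j - x j ∧ y j - x j < T) ∧ tdist x i j R y ≤ R then
    δ ^ 2 / (max 1 (tdist x i j R y : ℝ)) ^ 2 else 0

/-- The parametrisation of the slab `{0 ≤ y_j − x_j < T, tdist ≤ R}` by height and transverse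
offset. [cite: Chatterjee2026CentralU1, §4 (proof of Thm 3.1: the `T` slices)] -/
def slabSite (p : ℕ × Literature.Probability.LatticeModels.Site 2) : Literature.Probability.LatticeModels.Site 3 :=
  fwdBase x i R + Fin.insertNth (α := fun _ => ℤ) j (p.1 : ℤ) p.2

variable {x i j R T δ}

/-- The truncated logarithmic potential at distance `0` is `δ log(R+1)`. [folklore] -/
private theorem logPot_zero : logPot δ R 0 = δ * Real.log (R + 1) := by
  simp [logPot]

/-- The truncated logarithmic potential vanishes beyond `R`. [folklore] -/
private theorem logPot_of_le {m : ℕ} (h : R ≤ m) : logPot δ R m = 0 := by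
  simp [logPot, min_eq_right h]

/-- The truncated logarithmic potential is non-negative. [folklore] -/
private theorem logPot_nonneg (hδ : 0 ≤ δ) (m : ℕ) : 0 ≤ logPot δ R m := by
  unfold logPot
  refine mul_nonneg hδ (sub_nonneg.2 (Real.log_le_log (by positivity) ?_))
  have : (min m R : ℝ) ≤ R := by exact_mod_cast min_le_right m R
  push_cast
  linarith

/-- `|log u − log u'| ≤ 1/m` for reals `u, u' ≥ m > 0` with `|u − u'| ≤ 1`. [folklore] -/
private theorem abs_log_sub_log_le {u u' m : ℝ} (hm : 0 < m) (hu : m ≤ u) (hu' : m ≤ u')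
    (h1 : u' ≤ u + 1) (h2 : u ≤ u' + 1) : |Real.log u - Real.log u'| ≤ 1 / m := by
  have hu0 : 0 < u := hm.trans_le hu
  have hu0' : 0 < u' := hm.trans_le hu'
  rw [abs_le]
  constructor
  · -- log u' - log u ≤ 1/m
    have h := Real.log_le_sub_one_of_pos (div_pos hu0' hu0)
    rw [Real.log_div hu0'.ne' hu0.ne'] at h
    have : u' / u - 1 ≤ 1 / m := by
      rw [div_sub_one hu0.ne', div_le_div_iff₀ hu0 hm]
      nlinarith
    linarith
  · have h := Real.log_le_sub_one_of_pos (div_pos hu0 hu0')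
    rw [Real.log_div hu0.ne' hu0'.ne'] at h
    have : u / u' - 1 ≤ 1 / m := by
      rw [div_sub_one hu0'.ne', div_le_div_iff₀ hu0' hm]
      nlinarith
    linarith

/-- The potential is `δ/max(1,m)`-Lipschitz at `m` on unit steps and constant beyond `R`. [cite: GlimmJaffe1977QuarkTrapping, main estimate (gradient of the rotation field)] -/
theorem abs_logPot_sub_logPot_le (hδ : 0 ≤ δ) {m m' : ℕ} (h1 : m' ≤ m + 1) (h2 : m ≤ m' + 1) :
    |logPot δ R m' - logPot δ R m| ≤ if m ≤ R then δ / max 1 (m : ℝ) else 0 := by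
  split_ifs with hmR
  · unfold logPot
    rw [← mul_sub, abs_mul, abs_of_nonneg hδ, div_eq_mul_one_div]
    refine mul_le_mul_of_nonneg_left ?_ hδ
    rw [show Real.log (R + 1) - Real.log (min m' R + 1) - (Real.log (R + 1) - Real.log (min m R + 1)) =
      Real.log (min m R + 1) - Real.log (min m' R + 1) by ring]
    have hm0 : (0 : ℝ) < max 1 (m : ℝ) := lt_max_of_lt_left one_pos
    refine abs_log_sub_log_le hm0 ?_ ?_ ?_ ?_
    · rw [min_eq_left hmR]
      exact max_le (by simp) (by simp)
    · refine max_le ?_ ?_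
      · have : (0 : ℝ) ≤ (min m' R : ℕ) := Nat.cast_nonneg _
        linarith
      · have : m ≤ min m' R + 1 := by omega
        exact_mod_cast this
    · have : min m' R ≤ min m R + 1 := by omega
      have : ((min m' R : ℕ) : ℝ) ≤ (min m R : ℕ) + 1 := by exact_mod_cast this
      linarith
    · have : min m R ≤ min m' R + 1 := by omega
      have : ((min m R : ℕ) : ℝ) ≤ (min m' R : ℕ) + 1 := by exact_mod_cast this
      linarith
  · rw [logPot_of_le (by omega : R ≤ m), logPot_of_le (by omega : R ≤ m'), sub_zero, abs_zero]

/-- `cosh t − 1 ≤ t²` for `|t| ≤ 1`. [folklore] -/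
private theorem cosh_sub_one_le_sq {t : ℝ} (ht : |t| ≤ 1) : Real.cosh t - 1 ≤ t ^ 2 := by
  have h1 := Real.cosh_le_exp_half_sq t
  have ht2 : t ^ 2 ≤ 1 := by
    have := abs_le.1 ht; nlinarith
  have h2 : |t ^ 2 / 2| ≤ 1 := by rw [abs_of_nonneg (by positivity)]; linarith
  have h3 := Real.abs_exp_sub_one_le h2
  rw [abs_of_nonneg (by positivity : (0:ℝ) ≤ t ^ 2 / 2)] at h3
  have h4 := (abs_le.1 h3).2
  linarith

/-! #### Transverse geometry -/

/-- The transverse part is additive. [folklore] -/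
private theorem transverse_add (w w' : Literature.Probability.LatticeModels.Site 3) :
    transverse j (w + w') = transverse j w + transverse j w' := rfl

/-- The transverse part respects subtraction. [folklore] -/
private theorem transverse_sub (w w' : Literature.Probability.LatticeModels.Site 3) :
    transverse j (w - w') = transverse j w - transverse j w' := rfl

/-- The transverse part of the `j`-unit vector vanishes. [folklore] -/
private theorem transverse_single_self (c : ℤ) : transverse j (Pi.single j c) = 0 := by
  funext a
  simp [transverse, Fin.removeNth]

/-- The sup norm is invariant under negation. [folklore] -/
private theorem supNorm_neg {d : ℕ} (v : Literature.Probability.LatticeModels.Site d) :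
    Literature.Probability.LatticeModels.Site.supNorm (-v) = Literature.Probability.LatticeModels.Site.supNorm v := by
  simp [Literature.Probability.LatticeModels.Site.supNorm]

/-- Unit vectors have sup norm at most one. [folklore] -/
private theorem supNorm_single_le_one {d : ℕ} (a : Fin d) :
    Literature.Probability.LatticeModels.Site.supNorm (Pi.single a (1 : ℤ)) ≤ 1 :=
  Literature.Probability.LatticeModels.Site.supNorm_le_iff.2 (AreaLaw.natAbs_single_apply_le_one a)

/-- Transverse parts of unit vectors have sup norm at most one. [folklore] -/
private theorem supNorm_transverse_single_le_one (m : Fin 3) :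
    Literature.Probability.LatticeModels.Site.supNorm (transverse j (Pi.single m (1 : ℤ))) ≤ 1 := by
  refine Literature.Probability.LatticeModels.Site.supNorm_le_iff.2 fun a => ?_
  exact AreaLaw.natAbs_single_apply_le_one m (j.succAbove a)

/-- A transverse unit step changes the transverse distance by at most one. [cite: GlimmJaffe1977QuarkTrapping, main estimate (gradient of the rotation field)] -/
theorem tdist_add_single_le (y : Literature.Probability.LatticeModels.Site 3) (m : Fin 3) :
    tdist x i j R (y + Pi.single m 1) ≤ tdist x i j R y + 1 ∧
      tdist x i j R y ≤ tdist x i j R (y + Pi.single m 1) + 1 := by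
  unfold tdist
  have he : y + Pi.single m 1 - fwdBase x i R = (y - fwdBase x i R) + Pi.single m 1 := by abel
  rw [he, transverse_add]
  set v := transverse j (y - fwdBase x i R)
  constructor
  · exact (Literature.Probability.LatticeModels.Site.supNorm_add_le _ _).trans
      (Nat.add_le_add_left (supNorm_transverse_single_le_one m) _)
  · have : v = (v + transverse j (Pi.single m 1)) + -transverse j (Pi.single m 1) := by abel
    calc Literature.Probability.LatticeModels.Site.supNorm v
        = Literature.Probability.LatticeModels.Site.supNorm
            ((v + transverse j (Pi.single m 1)) + -transverse j (Pi.single m 1)) := by rw [← this]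
      _ ≤ _ := Literature.Probability.LatticeModels.Site.supNorm_add_le _ _
      _ ≤ _ := by rw [supNorm_neg]; exact Nat.add_le_add_left (supNorm_transverse_single_le_one m) _

/-- On the forward `j`-side the transverse distance vanishes. [cite: Chatterjee2026CentralU1, §4 (proof of Thm 3.1: the edges `q_j`)] -/
theorem tdist_fwd (t : ℕ) : tdist x i j R (fwdBase x i R + Pi.single j (t : ℤ)) = 0 := by
  unfold tdist
  rw [add_sub_cancel_left, transverse_single_self]
  simp [Literature.Probability.LatticeModels.Site.supNorm]

/-- On the backward `j`-side the transverse distance is `R`. [cite: Chatterjee2026CentralU1, §4 (proof of Thm 3.1: the edges `p_j`)] -/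
theorem tdist_bwd (hij : i ≠ j) (t : ℕ) : tdist x i j R (x + Pi.single j (t : ℤ)) = R := by
  unfold tdist fwdBase
  have he : x + Pi.single j (t : ℤ) - (x + Pi.single i (R : ℤ)) = Pi.single j (t : ℤ) - Pi.single i (R : ℤ) := by
    abel
  rw [he, transverse_sub, transverse_single_self, zero_sub, supNorm_neg]
  obtain ⟨a₀, ha₀⟩ := Fin.exists_succAbove_eq hij
  apply le_antisymm
  · refine Literature.Probability.LatticeModels.Site.supNorm_le_iff.2 fun a => ?_
    simp only [transverse, Fin.removeNth]
    by_cases h : j.succAbove a = i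
    · rw [h]; simp
    · rw [Pi.single_eq_of_ne h]; simp
  · have h := Literature.Probability.LatticeModels.Site.natAbs_le_supNorm (transverse j (Pi.single i (R : ℤ))) a₀
    simp only [transverse, Fin.removeNth, ha₀, Pi.single_eq_same, Int.natAbs_natCast] at h
    exact h

/-! #### The loop sum and the plaquette sums of the rotation field -/

/-- The rotation field vanishes off the `j`-bonds. [folklore] -/
private theorem pot_of_ne {e : ZdEdge 3} (h : e.2 ≠ j) : pot x i j R T δ e = 0 := by
  simp [pot, h]

/-- **The gain**: the rotation field sums to `T δ log(R+1)` around the loop. [cite: GlimmJaffe1977QuarkTrapping, main estimate (the factor `e^{-a(C)}`)] -/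
theorem rectSum_pot (hij : i ≠ j) :
    rectSum (pot x i j R T δ) x i j R T = T * (δ * Real.log (R + 1)) := by
  unfold rectSum
  have h1 : lineSum (pot x i j R T δ) i R x = R * 0 :=
    lineSum_eq_mul_of_forall fun t _ => pot_of_ne hij
  have h3 : lineSum (pot x i j R T δ) i R (x + Pi.single j (T : ℤ)) = R * 0 :=
    lineSum_eq_mul_of_forall fun t _ => pot_of_ne hij
  have h2 : lineSum (pot x i j R T δ) j T (x + Pi.single i (R : ℤ)) = T * (δ * Real.log (R + 1)) := by
    refine lineSum_eq_mul_of_forall fun t ht => ?_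
    have hfwd := tdist_fwd (x := x) (i := i) (j := j) (R := R) t
    unfold fwdBase at hfwd
    simp only [pot, true_and, Pi.add_apply, Pi.single_eq_same, Pi.single_eq_of_ne' hij,
      add_zero, add_sub_cancel_left, hfwd, logPot_zero]
    rw [if_pos ⟨by positivity, by exact_mod_cast ht⟩]
  have h4 : lineSum (pot x i j R T δ) j T x = T * 0 := by
    refine lineSum_eq_mul_of_forall fun t ht => ?_
    simp only [pot, true_and, Pi.add_apply, Pi.single_eq_same, add_sub_cancel_left,
      tdist_bwd hij, logPot_of_le le_rfl]
    simp
  rw [h1, h2, h3, h4]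
  ring

/-- The site cost is non-negative. [folklore] -/
private theorem siteCost_nonneg (y : Literature.Probability.LatticeModels.Site 3) : 0 ≤ siteCost x i j R T δ y := by
  unfold siteCost
  split_ifs
  · positivity
  · exact le_rfl

/-- One transverse difference of the potential is at most `δ/max(1, tdist)` and vanishes beyond
`R`; hence its `cosh − 1` is at most the site cost. [cite: GlimmJaffe1977QuarkTrapping, main estimate (energy of the rotation field)] -/
theorem cosh_potDiff_sub_one_le (hδ0 : 0 ≤ δ) (hδ1 : δ ≤ 1)
    (y : Literature.Probability.LatticeModels.Site 3) (m : Fin 3)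
    (hh : 0 ≤ y j - x j ∧ y j - x j < T) :
    Real.cosh (logPot δ R (tdist x i j R (y + Pi.single m 1)) - logPot δ R (tdist x i j R y)) - 1 ≤
      siteCost x i j R T δ y := by
  have hst := tdist_add_single_le (x := x) (i := i) (j := j) (R := R) y m
  have hb := abs_logPot_sub_logPot_le (R := R) hδ0 hst.1 hst.2
  unfold siteCost
  by_cases hR : tdist x i j R y ≤ R
  · rw [if_pos hR] at hb
    rw [if_pos ⟨hh, hR⟩]
    have hm0 : (1 : ℝ) ≤ max 1 (tdist x i j R y : ℝ) := le_max_left _ _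
    have hle1 : |logPot δ R (tdist x i j R (y + Pi.single m 1)) - logPot δ R (tdist x i j R y)| ≤ 1 := by
      refine hb.trans ?_
      rw [div_le_one (by positivity)]
      exact hδ1.trans hm0
    refine (cosh_sub_one_le_sq hle1).trans ?_
    rw [← sq_abs]
    calc _ ≤ (δ / max 1 (tdist x i j R y : ℝ)) ^ 2 := pow_le_pow_left₀ (abs_nonneg _) hb 2
      _ = δ ^ 2 / (max 1 (tdist x i j R y : ℝ)) ^ 2 := div_pow _ _ _
  · rw [if_neg hR] at hb
    rw [if_neg (fun h => hR h.2)]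
    have h0 : logPot δ R (tdist x i j R (y + Pi.single m 1)) - logPot δ R (tdist x i j R y) = 0 :=
      abs_eq_zero.1 (le_antisymm hb (abs_nonneg _))
    rw [h0, Real.cosh_zero, sub_self]

/-- **The cost, per plaquette**: `cosh((d pot)_p) − 1 ≤ siteCost` of the base point. [cite: GlimmJaffe1977QuarkTrapping, main estimate (energy of the rotation field)] -/
theorem cosh_plaqSum_pot_sub_one_le (hδ0 : 0 ≤ δ) (hδ1 : δ ≤ 1)
    (y : Literature.Probability.LatticeModels.Site 3) (k l : Fin 3) :
    Real.cosh (plaqSum (pot x i j R T δ) y k l) - 1 ≤ siteCost x i j R T δ y := by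
  have h0 := siteCost_nonneg (x := x) (i := i) (j := j) (R := R) (T := T) (δ := δ) y
  unfold plaqSum
  by_cases hk : k = j <;> by_cases hl : l = j
  · simp only [hk, hl]
    rw [show ∀ a b : ℝ, a + b - b - a = 0 from fun a b => by ring, Real.cosh_zero, sub_self]
    exact h0
  · simp only [pot, hk, hl, true_and, false_and, if_false, add_zero,
      sub_zero, Pi.add_apply, Pi.single_eq_of_ne (Ne.symm hl), Pi.single_eq_same]
    by_cases hh : 0 ≤ y j - x j ∧ y j - x j < T
    · rw [if_pos hh, if_pos hh, ← Real.cosh_neg, neg_sub]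
      exact cosh_potDiff_sub_one_le hδ0 hδ1 y l hh
    · rw [if_neg hh, if_neg hh, sub_zero, Real.cosh_zero, sub_self]; exact h0
  · simp only [pot, hk, hl, true_and, false_and, if_false, zero_add, add_zero,
      sub_zero, Pi.add_apply, Pi.single_eq_of_ne (Ne.symm hk), Pi.single_eq_same]
    by_cases hh : 0 ≤ y j - x j ∧ y j - x j < T
    · rw [if_pos hh, if_pos hh]
      exact cosh_potDiff_sub_one_le hδ0 hδ1 y k hh
    · rw [if_neg hh, if_neg hh, sub_zero, Real.cosh_zero, sub_self]; exact h0
  · simp only [pot, hk, hl, false_and, if_false, add_zero, sub_self, Real.cosh_zero]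
    exact h0


/-! #### Summing the cost: two-dimensional shells -/

/-- The two-dimensional shell sum `∑_{‖v‖∞ ≤ R} 1/max(1,‖v‖∞)²`. [cite: GlimmJaffe1977QuarkTrapping, main estimate (energy of the rotation field ≈ log R)] -/
def shellSum (R : ℕ) : ℝ :=
  ∑ v ∈ box 2 R, 1 / (max 1 (Literature.Probability.LatticeModels.Site.supNorm v : ℝ)) ^ 2

/-- `|∂Q_0| ≤ 1` and `|∂Q_{k+1}| ≤ 4(2k+3)` in `ℤ²`, as the weighted bound
`|∂Q_r| / max(1,r)² ≤ (r = 0 ? 1 : 20/r)`. [folklore] -/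
private theorem card_sphere_two_div_le (r : ℕ) :
    (#(sphere 2 r) : ℝ) / (max 1 (r : ℝ)) ^ 2 ≤ if r = 0 then (1 : ℝ) else 20 / (r : ℝ) := by
  rcases Nat.eq_zero_or_pos r with rfl | hr
  · simp only [Nat.cast_zero, if_true]
    have h1 : #(sphere 2 0) ≤ 1 := by
      calc #(sphere 2 0) ≤ #(box 2 0) := card_le_card (sphere_subset_box 2 0)
        _ = 1 := by rw [card_box]; norm_num
    have h1' : (#(sphere 2 0) : ℝ) ≤ 1 := by exact_mod_cast h1
    rw [max_eq_left (by norm_num : (0:ℝ) ≤ 1), one_pow, div_one]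
    exact h1'
  · obtain ⟨k, rfl⟩ : ∃ k, r = k + 1 := ⟨r - 1, by omega⟩
    rw [if_neg (Nat.succ_ne_zero k)]
    have h := card_sphere_succ_le (d := 2) k
    have hk1 : (1 : ℝ) ≤ ((k + 1 : ℕ) : ℝ) := by exact_mod_cast Nat.le_add_left 1 k
    rw [max_eq_right hk1, div_le_div_iff₀ (by positivity) (by positivity)]
    push_cast at h ⊢
    simp only [pow_one] at h
    nlinarith

/-- **The two-dimensional Coulomb energy is logarithmic**: `∑_{‖v‖∞ ≤ R} 1/max(1,‖v‖∞)² ≤ 21(1 + log(R+1))`. [cite: GlimmJaffe1977QuarkTrapping, main estimate (energy of the rotation field ≈ log R)] -/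
theorem shellSum_le (R : ℕ) : shellSum R ≤ 21 * (1 + Real.log (R + 1)) := by
  unfold shellSum
  have hmaps : ∀ v ∈ box 2 R, Literature.Probability.LatticeModels.Site.supNorm v ∈ range (R + 1) :=
    fun v hv => mem_range.2 (Nat.lt_succ_of_le (mem_box_iff_supNorm_le.1 hv))
  rw [← sum_fiberwise_of_maps_to' hmaps (fun r : ℕ => 1 / (max 1 (r : ℝ)) ^ 2)]
  have hfib : ∀ r ∈ range (R + 1),
      ∑ v ∈ box 2 R with Literature.Probability.LatticeModels.Site.supNorm v = r, 1 / (max 1 (r : ℝ)) ^ 2 ≤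
        if r = 0 then (1 : ℝ) else 20 / (r : ℝ) := by
    intro r _
    rw [sum_const, nsmul_eq_mul, ← div_eq_mul_one_div]
    refine le_trans ?_ (card_sphere_two_div_le r)
    gcongr
    intro v hv
    rw [mem_filter] at hv
    exact mem_sphere.2 hv.2
  refine (sum_le_sum hfib).trans ?_
  rw [sum_range_succ']
  simp only [Nat.succ_ne_zero, if_false, if_true]
  have hharm : ∑ k ∈ range R, (20 : ℝ) / (k + 1 : ℕ) = 20 * (harmonic R : ℝ) := by
    simp only [harmonic, Rat.cast_sum, Rat.cast_inv, Rat.cast_natCast, mul_sum]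
    refine sum_congr rfl fun k _ => ?_
    rw [div_eq_mul_inv]
  rw [hharm]
  have hH := harmonic_le_one_add_log R
  have hlog : Real.log R ≤ Real.log (R + 1) := by
    rcases Nat.eq_zero_or_pos R with rfl | hR
    · simp
    · exact Real.log_le_log (by exact_mod_cast hR) (by linarith)
  have hlog0 : 0 ≤ Real.log ((R : ℝ) + 1) := Real.log_nonneg (by linarith [(Nat.cast_nonneg R : (0:ℝ) ≤ R)])
  linarith

/-! #### Summing the cost over the plaquettes of a region -/

/-- The forward base point has the same `j`-coordinate as `x`. [folklore] -/
private theorem fwdBase_apply_j (hij : i ≠ j) : fwdBase x i R j = x j := by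
  simp [fwdBase, Pi.single_eq_of_ne' hij]

/-- The height of a parametrised slab site. [folklore] -/
private theorem slabSite_height (hij : i ≠ j) (p : ℕ × Literature.Probability.LatticeModels.Site 2) :
    slabSite x i j R p j - x j = p.1 := by
  simp [slabSite, fwdBase_apply_j hij, Fin.insertNth_apply_same]

/-- The transverse distance of a parametrised slab site. [folklore] -/
private theorem tdist_slabSite (p : ℕ × Literature.Probability.LatticeModels.Site 2) :
    tdist x i j R (slabSite x i j R p) = Literature.Probability.LatticeModels.Site.supNorm p.2 := by
  unfold tdist slabSite transverse
  rw [add_sub_cancel_left, Fin.removeNth_insertNth]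

/-- The site cost along the slab parametrisation. [folklore] -/
private theorem siteCost_slabSite (hij : i ≠ j) {p : ℕ × Literature.Probability.LatticeModels.Site 2}
    (hp : p ∈ range T ×ˢ box 2 R) :
    siteCost x i j R T δ (slabSite x i j R p) =
      δ ^ 2 / (max 1 (Literature.Probability.LatticeModels.Site.supNorm p.2 : ℝ)) ^ 2 := by
  rw [mem_product, mem_range, mem_box_iff_supNorm_le] at hp
  unfold siteCost
  rw [slabSite_height hij, tdist_slabSite, if_pos]
  exact ⟨⟨by positivity, by exact_mod_cast hp.1⟩, hp.2⟩

/-- The slab parametrisation is injective. [folklore] -/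
private theorem slabSite_injOn : Set.InjOn (slabSite x i j R) (range T ×ˢ box 2 R : Finset _) := by
  intro p _ q _ h
  unfold slabSite at h
  have h' := add_left_cancel h
  rw [Fin.insertNth_inj] at h'
  exact Prod.ext (by exact_mod_cast h'.1) h'.2

/-- Sites of non-zero cost lie in the parametrised slab. [folklore] -/
private theorem mem_image_slabSite_of_siteCost_ne_zero (hij : i ≠ j) {y : Literature.Probability.LatticeModels.Site 3}
    (hy : siteCost x i j R T δ y ≠ 0) : y ∈ (range T ×ˢ box 2 R).image (slabSite x i j R) := by
  unfold siteCost at hy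
  split_ifs at hy with hc
  · obtain ⟨⟨h0, hT⟩, hR⟩ := hc
    refine mem_image.2 ⟨((y j - x j).toNat, transverse j (y - fwdBase x i R)), ?_, ?_⟩
    · rw [mem_product, mem_range, mem_box_iff_supNorm_le]
      refine ⟨?_, hR⟩
      have : ((y j - x j).toNat : ℤ) < T := by rw [Int.toNat_of_nonneg h0]; exact hT
      exact_mod_cast this
    · unfold slabSite
      rw [Int.toNat_of_nonneg h0]
      have hj : y j - x j = (y - fwdBase x i R) j := by simp [fwdBase_apply_j hij]
      rw [hj]
      unfold transverse
      rw [Fin.insertNth_self_removeNth, add_sub_cancel]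
  · exact absurd rfl hy

/-- **The cost of the rotation field over any region**:
`∑_{p ∈ P(Λ)} (cosh((d pot)_p) − 1) ≤ 189 T δ² (1 + log(R+1))`, uniformly in `Λ`. [cite: GlimmJaffe1977QuarkTrapping, main estimate (energy of the rotation field ≈ T log R / β)] -/
theorem sum_cosh_plaqSum_pot_sub_one_le (hij : i ≠ j) (hδ0 : 0 ≤ δ) (hδ1 : δ ≤ 1)
    (Λ : Finset (Literature.Probability.LatticeModels.Site 3)) :
    ∑ p ∈ plaquettesIn Λ, (Real.cosh (plaqSum (pot x i j R T δ) p.1 p.2.1 p.2.2) - 1) ≤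
      189 * T * δ ^ 2 * (1 + Real.log (R + 1)) := by
  classical
  have hnn := siteCost_nonneg (x := x) (i := i) (j := j) (R := R) (T := T) (δ := δ)
  -- (i) per plaquette
  have h1 : ∑ p ∈ plaquettesIn Λ, (Real.cosh (plaqSum (pot x i j R T δ) p.1 p.2.1 p.2.2) - 1) ≤
      ∑ p ∈ plaquettesIn Λ, siteCost x i j R T δ p.1 :=
    sum_le_sum fun p _ => cosh_plaqSum_pot_sub_one_le hδ0 hδ1 p.1 p.2.1 p.2.2
  -- (ii) enlarge to `Λ × Fin 3 × Fin 3`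
  have h2 : ∑ p ∈ plaquettesIn Λ, siteCost x i j R T δ p.1 ≤
      ∑ p ∈ Λ ×ˢ ((univ : Finset (Fin 3)) ×ˢ (univ : Finset (Fin 3))), siteCost x i j R T δ p.1 :=
    sum_le_sum_of_subset_of_nonneg (by unfold plaquettesIn; exact filter_subset _ _)
      fun p _ _ => hnn p.1
  -- (iii) the `9` pairs of directions
  have h3 : ∑ p ∈ Λ ×ˢ ((univ : Finset (Fin 3)) ×ˢ (univ : Finset (Fin 3))), siteCost x i j R T δ p.1 =
      9 * ∑ y ∈ Λ, siteCost x i j R T δ y := by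
    rw [sum_product, mul_sum]
    refine sum_congr rfl fun y _ => ?_
    dsimp only
    rw [sum_const, card_product, card_univ, Fintype.card_fin, nsmul_eq_mul]
    norm_num
  -- (iv) restrict to the slab
  set Y := (range T ×ˢ box 2 R).image (slabSite x i j R) with hY
  have h4 : ∑ y ∈ Λ, siteCost x i j R T δ y ≤ ∑ y ∈ Y, siteCost x i j R T δ y := by
    rw [← sum_filter_add_sum_filter_not Λ (· ∈ Y)]
    have hz : ∑ y ∈ Λ with ¬ y ∈ Y, siteCost x i j R T δ y = 0 := by
      refine sum_eq_zero fun y hy => ?_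
      rw [mem_filter] at hy
      by_contra hne
      exact hy.2 (mem_image_slabSite_of_siteCost_ne_zero hij hne)
    rw [hz, add_zero]
    exact sum_le_sum_of_subset_of_nonneg (fun y hy => (mem_filter.1 hy).2) fun y _ _ => hnn y
  -- (v) the slab sum
  have h5 : ∑ y ∈ Y, siteCost x i j R T δ y = T * (δ ^ 2 * shellSum R) := by
    rw [hY, sum_image (slabSite_injOn (x := x) (i := i) (j := j) (R := R) (T := T))]
    rw [sum_congr rfl fun p hp => siteCost_slabSite (δ := δ) hij hp, sum_product]
    dsimp only
    rw [sum_const, card_range, nsmul_eq_mul]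
    congr 1
    rw [shellSum, mul_sum]
    exact sum_congr rfl fun v _ => by rw [div_eq_mul_one_div]
  -- (vi) shells
  have h6 := shellSum_le R
  have hT : (0 : ℝ) ≤ T := Nat.cast_nonneg T
  calc _ ≤ 9 * ∑ y ∈ Λ, siteCost x i j R T δ y := by rw [← h3]; exact h1.trans h2
    _ ≤ 9 * (T * (δ ^ 2 * shellSum R)) := by rw [← h5]; gcongr
    _ ≤ 9 * (T * (δ ^ 2 * (21 * (1 + Real.log (R + 1))))) := by gcongr
    _ = 189 * T * δ ^ 2 * (1 + Real.log (R + 1)) := by ring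

end Potential


/-! ### E. Assembly: the expanded model, the rotation bound for the auxiliary variables, Fubini -/

section Assembly

variable {G : Type*} [Group G] [TopologicalSpace G] [IsTopologicalGroup G] [CompactSpace G]
  [MeasurableSpace G] [BorelSpace G]

/-- **Left multiplication by a fixed configuration preserves `dg_∞`**: `∫ F(c·U) dU = ∫ F(U) dU`
(Chatterjee 2026 §4: «the invariance of `σ` implies … `∫ f(χU) dν = ∫ f(U) dμ`»). [cite: Chatterjee2026CentralU1, §4 (proof of Thm 3.1, display `∫ f(χU) dν(U,χ) = ∫ f(U) dμ(U)`)] -/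
theorem integral_zdHaar_comp_mul_left {d : ℕ} (c : ZdGaugeConfig d G) {E : Type*} [NormedAddCommGroup E]
    [NormedSpace ℝ E] {F : ZdGaugeConfig d G → E} (hF : AEStronglyMeasurable F (zdHaar d G)) :
    ∫ U, F (fun e => c e * U e) ∂zdHaar d G = ∫ U, F U ∂zdHaar d G := by
  have hτ : Measurable (fun (U : ZdGaugeConfig d G) e => c e * U e) :=
    measurable_pi_lambda _ fun e => (measurable_const_mul (c e)).comp (measurable_pi_apply e)
  have hmap : (zdHaar d G).map (fun (U : ZdGaugeConfig d G) e => c e * U e) = zdHaar d G := by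
    unfold zdHaar
    exact Literature.Probability.LatticeModels.map_pi_infinitePi (haarProbability G)
      (f := fun e g => c e * g) (fun e => measurable_const_mul (c e)) (fun e => map_mul_left_eq_self _ _)
  rw [← integral_map hτ.aemeasurable (by rw [hmap]; exact hF), hmap]

variable {n : ℕ} (ρ : G →* Matrix (Fin n) (Fin n) ℂ)

/-- `‖tr M‖ ≤ n` for a unitary `n × n` matrix. [folklore] -/
private theorem norm_trace_le_of_mem_unitaryGroup {M : Matrix (Fin n) (Fin n) ℂ}
    (hM : M ∈ Matrix.unitaryGroup (Fin n) ℂ) : ‖M.trace‖ ≤ n := by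
  calc ‖M.trace‖ = ‖∑ k, M k k‖ := rfl
    _ ≤ ∑ k, ‖M k k‖ := norm_sum_le _ _
    _ ≤ ∑ _k : Fin n, (1 : ℝ) := Finset.sum_le_sum fun k _ => entry_norm_bound_of_unitary hM k k
    _ = n := by simp

variable (Λ : Finset (Literature.Probability.LatticeModels.Site 3))

/-- The bonds based in the region `Λ` (they carry the auxiliary `U(1)` variables; every bond of a
plaquette of `Λ` and of a loop inside `Λ` is among them). [cite: Chatterjee2026CentralU1, §4 (expanded model on `E(Λ)`)] -/
def bondsOf : Finset (ZdEdge 3) := Λ ×ˢ (univ : Finset (Fin 3))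

/-- Membership in `bondsOf Λ`: the base point lies in `Λ`. [folklore] -/
private theorem mem_bondsOf {e : ZdEdge 3} : e ∈ bondsOf Λ ↔ e.1 ∈ Λ := by
  simp [bondsOf]

variable {Λ}

/-- The four bonds of a plaquette of `Λ` are based in `Λ`. [folklore] -/
private theorem plaqSum_extPot_eq (a : ↥(bondsOf Λ) → ℝ) (b : ZdEdge 3 → ℝ)
    (hab : ∀ e (h : e ∈ bondsOf Λ), a ⟨e, h⟩ = b e) {p : Plaq 3} (hp : p ∈ plaquettesIn Λ) :
    plaqSum (extPot (bondsOf Λ) a) p.1 p.2.1 p.2.2 = plaqSum b p.1 p.2.1 p.2.2 := by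
  rw [Plaq.mem_plaquettesIn] at hp
  obtain ⟨h1, -, h2, h3, -⟩ := hp
  have e1 : extPot (bondsOf Λ) a (p.1, p.2.1) = b (p.1, p.2.1) := by
    rw [extPot_apply_of_mem _ _ ((mem_bondsOf Λ).2 h1), hab]
  have e2 : extPot (bondsOf Λ) a (p.1 + Pi.single p.2.1 1, p.2.2) = b (p.1 + Pi.single p.2.1 1, p.2.2) := by
    rw [extPot_apply_of_mem _ _ ((mem_bondsOf Λ).2 h2), hab]
  have e3 : extPot (bondsOf Λ) a (p.1 + Pi.single p.2.2 1, p.2.1) = b (p.1 + Pi.single p.2.2 1, p.2.1) := by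
    rw [extPot_apply_of_mem _ _ ((mem_bondsOf Λ).2 h3), hab]
  have e4 : extPot (bondsOf Λ) a (p.1, p.2.2) = b (p.1, p.2.2) := by
    rw [extPot_apply_of_mem _ _ ((mem_bondsOf Λ).2 h1), hab]
  simp only [plaqSum, e1, e2, e3, e4]

/-- Sites of the filled rectangle. [folklore] -/
private theorem mem_rectangleSites {x : Literature.Probability.LatticeModels.Site 3} {i j : Fin 3}
    {R T s t : ℕ} (hs : s ≤ R) (ht : t ≤ T) :
    x + Pi.single i (s : ℤ) + Pi.single j (t : ℤ) ∈ rectangleSites x i j R T :=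
  Finset.mem_image.2 ⟨(s, t), Finset.mem_product.2 ⟨Finset.mem_range.2 (Nat.lt_succ_of_le hs),
    Finset.mem_range.2 (Nat.lt_succ_of_le ht)⟩, rfl⟩

/-- **The gain on the auxiliary torus**: the loop sum of the extended potential is `T δ log(R+1)`. [cite: GlimmJaffe1977QuarkTrapping, main estimate (the factor `e^{-a(C)}`)] -/
theorem rectSum_extPot_pot {x : Literature.Probability.LatticeModels.Site 3} {i j : Fin 3} (hij : i ≠ j)
    {R T : ℕ} {δ : ℝ} (hΛ : rectangleSites x i j R T ⊆ Λ) :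
    rectSum (extPot (bondsOf Λ) fun s => pot x i j R T δ s.1) x i j R T = T * (δ * Real.log (R + 1)) := by
  set a : ↥(bondsOf Λ) → ℝ := fun s => pot x i j R T δ s.1
  have hi : ∀ e : ZdEdge 3, e.2 = i → extPot (bondsOf Λ) a e = 0 := by
    intro e he
    unfold extPot
    split_ifs with h
    · exact pot_of_ne (by rw [he]; exact hij)
    · rfl
  have hj : ∀ e : ZdEdge 3, e.1 ∈ Λ → extPot (bondsOf Λ) a e = pot x i j R T δ e := fun e he =>
    extPot_apply_of_mem _ _ ((mem_bondsOf Λ).2 he)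
  rw [← rectSum_pot (x := x) (R := R) (T := T) (δ := δ) hij]
  unfold rectSum
  have l1 : lineSum (extPot (bondsOf Λ) a) i R x = lineSum (pot x i j R T δ) i R x :=
    lineSum_congr fun t _ => by rw [hi _ rfl, pot_of_ne hij]
  have l3 : lineSum (extPot (bondsOf Λ) a) i R (x + Pi.single j (T : ℤ)) =
      lineSum (pot x i j R T δ) i R (x + Pi.single j (T : ℤ)) :=
    lineSum_congr fun t _ => by rw [hi _ rfl, pot_of_ne hij]
  have l2 : lineSum (extPot (bondsOf Λ) a) j T (x + Pi.single i (R : ℤ)) =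
      lineSum (pot x i j R T δ) j T (x + Pi.single i (R : ℤ)) :=
    lineSum_congr fun t ht => hj _ (hΛ (mem_rectangleSites le_rfl ht.le))
  have l4 : lineSum (extPot (bondsOf Λ) a) j T x = lineSum (pot x i j R T δ) j T x :=
    lineSum_congr fun t ht => hj _ (hΛ (by
      have := mem_rectangleSites (x := x) (i := i) (j := j) (R := R) (T := T) (Nat.zero_le R) ht.le
      simpa using this))
  rw [l1, l2, l3, l4]

variable (ι : Circle →* G)

/-- The twisted configuration `(ι(χ_e) U_e)_e` of the expanded model. [cite: Chatterjee2026CentralU1, §4 (expanded model, `χU`)] -/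
def twistCfg (z : ↥(bondsOf Λ) → Circle) (U : ZdGaugeConfig 3 G) : ZdGaugeConfig 3 G :=
  fun e => ι (extConfig (bondsOf Λ) z e) * U e

variable {ρ ι}

omit [TopologicalSpace G] [IsTopologicalGroup G] [CompactSpace G] [MeasurableSpace G] [BorelSpace G] in
/-- The twisted Wilson loop is `Re(κ χ_ℓ)`, `κ = tr ρ(U_ℓ)/n`. [cite: Chatterjee2026CentralU1, §4 (proof of Thm 3.1: `E(W_ℓ) = E(χ_ℓ Q_ℓ)`)] -/
theorem zdWilsonLoop_twistCfg (hι : ∀ w g, ι w * g = g * ι w)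
    (hρι : ∀ w : Circle, ρ (ι w) = (w : ℂ) • (1 : Matrix (Fin n) (Fin n) ℂ))
    (z : ↥(bondsOf Λ) → Circle) (U : ZdGaugeConfig 3 G)
    (x : Literature.Probability.LatticeModels.Site 3) (i j : Fin 3) (R T : ℕ) :
    zdWilsonLoop ρ x i j R T (twistCfg ι z U) =
      (((n : ℂ)⁻¹ * (ρ (U.rectangle x i j R T)).trace) *
        ((loopChar (bondsOf Λ) x i j R T z : Circle) : ℂ)).re := by
  have hrect : (twistCfg ι z U).rectangle x i j R T =
      ι ((extConfig (bondsOf Λ) z).rectangle x i j R T) * U.rectangle x i j R T :=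
    rectangle_central_mul ι hι (extConfig (bondsOf Λ) z) U x i j R T
  simp only [zdWilsonLoop, hrect, rho_mul_of_scalar ρ hρι, Matrix.trace_smul, smul_eq_mul, loopChar_apply]
  have h1 : (n : ℂ)⁻¹ * (ρ (U.rectangle x i j R T)).trace *
      (((extConfig (bondsOf Λ) z).rectangle x i j R T : Circle) : ℂ) =
      (((n : ℝ)⁻¹ : ℝ) : ℂ) * ((((extConfig (bondsOf Λ) z).rectangle x i j R T : Circle) : ℂ) *
        (ρ (U.rectangle x i j R T)).trace) := by
    push_cast; ring
  rw [h1, Complex.re_ofReal_mul]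

omit [TopologicalSpace G] [IsTopologicalGroup G] [CompactSpace G] [MeasurableSpace G] [BorelSpace G] in
/-- The twisted Wilson weight is `e^{-βn|P|}` times the complex-coupling Gibbs weight of the
auxiliary variables, with couplings `K_p = β tr ρ(U_p)` on the plaquette characters. [cite: Chatterjee2026CentralU1, §4 (expanded model: density `exp(-β Σ Re Tr(I − χ_p U_p))`)] -/
theorem weight_twistCfg (hι : ∀ w g, ι w * g = g * ι w)
    (hρι : ∀ w : Circle, ρ (ι w) = (w : ℂ) • (1 : Matrix (Fin n) (Fin n) ℂ))
    (β : ℝ) (z : ↥(bondsOf Λ) → Circle) (U : ZdGaugeConfig 3 G) :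
    Real.exp (-β * zdWilsonAction ρ Λ (twistCfg ι z U)) =
      Real.exp (-β * n * #(plaquettesIn Λ)) *
        complexGinibreWeight (fun p : ↥(plaquettesIn Λ) => plaqChar (bondsOf Λ) p.1.1 p.1.2.1 p.1.2.2)
          (fun p => (β : ℂ) * (ρ (U.plaquette p.1.1 p.1.2.1 p.1.2.2)).trace) z := by
  have hplaq : ∀ p : Plaq 3, (twistCfg ι z U).plaquette p.1 p.2.1 p.2.2 =
      ι ((extConfig (bondsOf Λ) z).plaquette p.1 p.2.1 p.2.2) * U.plaquette p.1 p.2.1 p.2.2 := fun p =>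
    plaquette_central_mul ι hι (extConfig (bondsOf Λ) z) U p.1 p.2.1 p.2.2
  simp only [complexGinibreWeight, complexHamiltonian, zdWilsonAction, hplaq, rho_mul_of_scalar ρ hρι,
    Matrix.trace_smul, smul_eq_mul, plaqChar_apply]
  rw [← Real.exp_add]
  congr 1
  rw [Finset.sum_coe_sort (plaquettesIn Λ)
    (fun p => ((β : ℂ) * (ρ (U.plaquette p.1 p.2.1 p.2.2)).trace *
      ((((extConfig (bondsOf Λ) z).plaquette p.1 p.2.1 p.2.2 : Circle)) : ℂ)).re)]
  rw [Finset.sum_sub_distrib, Finset.sum_const, nsmul_eq_mul, mul_sub, Finset.mul_sum]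
  have hc : -β * (#(plaquettesIn Λ) * (n : ℝ)) = -β * n * #(plaquettesIn Λ) := by ring
  rw [hc, sub_eq_add_neg, ← Finset.sum_neg_distrib]
  congr 1
  refine Finset.sum_congr rfl fun p _ => ?_
  have h1 : (β : ℂ) * (ρ (U.plaquette p.1 p.2.1 p.2.2)).trace *
      (((extConfig (bondsOf Λ) z).plaquette p.1 p.2.1 p.2.2 : Circle) : ℂ) =
      ((β : ℝ) : ℂ) * ((((extConfig (bondsOf Λ) z).plaquette p.1 p.2.1 p.2.2 : Circle) : ℂ) *
        (ρ (U.plaquette p.1 p.2.1 p.2.2)).trace) := by ring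
  rw [h1, Complex.re_ofReal_mul]
  ring


omit [CompactSpace G] [MeasurableSpace G] [BorelSpace G] in
/-- The twisted configuration is jointly continuous in the auxiliary variables and the gauge field. [folklore] -/
private theorem continuous_twistCfg (hιc : Continuous ι) :
    Continuous fun p : (↥(bondsOf Λ) → Circle) × ZdGaugeConfig 3 G => twistCfg ι p.1 p.2 := by
  refine continuous_pi fun e => ?_
  exact (hιc.comp ((continuous_apply e).comp ((continuous_extConfig (bondsOf Λ)).comp continuous_fst))).mul
    ((continuous_apply e).comp continuous_snd)

/-- The observables of the expanded model are jointly integrable. [folklore] -/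
private theorem integrable_twistCfg_prod [MeasurableSpace Circle] [BorelSpace Circle] [SecondCountableTopology G] (hιc : Continuous ι)
    {F : ZdGaugeConfig 3 G → ℝ} (hF : Continuous F) :
    Integrable (Function.uncurry fun z U => F (twistCfg ι z U))
      ((torusHaar ↥(bondsOf Λ)).prod (zdHaar 3 G)) :=
  Literature.Probability.LatticeModels.integrable_of_continuous_of_compactSpace _
    (hF.comp (continuous_twistCfg (Λ := Λ) hιc))

/-- The partial integrals over the auxiliary variables are integrable in the gauge field. [folklore] -/
private theorem integrable_integral_twistCfg [MeasurableSpace Circle] [BorelSpace Circle] [SecondCountableTopology G] (hιc : Continuous ι)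
    {F : ZdGaugeConfig 3 G → ℝ} (hF : Continuous F) :
    Integrable (fun U => ∫ z, F (twistCfg ι z U) ∂torusHaar ↥(bondsOf Λ)) (zdHaar 3 G) :=
  (integrable_twistCfg_prod (Λ := Λ) hιc hF).swap.integral_prod_left

/-- **Fubini for the expanded model** (Chatterjee 2026 §4, `Z̃ = Z` and `∫ f(χU) dν = ∫ f dμ`):
`∫ F(U) dU = ∫ (∫ F(ι(χ)U) dχ) dU` for continuous `F`. [cite: Chatterjee2026CentralU1, §4 (proof of Thm 3.1: `Z̃ = Z`, display `∫ f(χU) dν(U,χ) = ∫ f(U) dμ(U)`)] -/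
theorem integral_eq_integral_integral_twistCfg [MeasurableSpace Circle] [BorelSpace Circle] [SecondCountableTopology G] (hιc : Continuous ι)
    {F : ZdGaugeConfig 3 G → ℝ} (hF : Continuous F) :
    ∫ U, F U ∂zdHaar 3 G =
      ∫ U, (∫ z, F (twistCfg ι z U) ∂torusHaar ↥(bondsOf Λ)) ∂zdHaar 3 G := by
  have hint := integrable_twistCfg_prod (Λ := Λ) hιc hF
  calc ∫ U, F U ∂zdHaar 3 G
      = ∫ _z, (∫ U, F U ∂zdHaar 3 G) ∂torusHaar ↥(bondsOf Λ) := by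
        rw [integral_const, probReal_univ, one_smul]
    _ = ∫ z, (∫ U, F (twistCfg ι z U) ∂zdHaar 3 G) ∂torusHaar ↥(bondsOf Λ) := by
        refine integral_congr_ae (ae_of_all _ fun z => ?_)
        exact (integral_zdHaar_comp_mul_left (fun e => ι (extConfig (bondsOf Λ) z e))
          hF.aestronglyMeasurable).symm
    _ = ∫ U, (∫ z, F (twistCfg ι z U) ∂torusHaar ↥(bondsOf Λ)) ∂zdHaar 3 G :=
        integral_integral_swap hint

omit [TopologicalSpace G] [IsTopologicalGroup G] [CompactSpace G] [MeasurableSpace G] [BorelSpace G] in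
/-- **The rotation bound for the auxiliary variables** (McBryan–Spencer / Glimm–Jaffe on the torus
`U(1)^S` with the plaquette characters and arbitrary complex couplings): for every real field `a`,
`|∫ Re(κ χ_ℓ) · C e^{∑ Re(K_p χ_p)} dχ| ≤ e^{-a(ℓ)} exp(M ∑_p (cosh (da)_p − 1)) ∫ C e^{∑ Re(K_p χ_p)} dχ`
when `‖κ‖ ≤ 1`, `‖K_p‖ ≤ M`, `C ≥ 0`. [cite: GlimmJaffe1977QuarkTrapping, main estimate (complex rotation of the `U(1)` variables)] -/
theorem abs_integral_loopChar_weight_le [MeasurableSpace Circle] [BorelSpace Circle]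
    (S : Finset (ZdEdge 3)) (P : Finset (Plaq 3)) (a : ↥S → ℝ)
    (x : Literature.Probability.LatticeModels.Site 3) (i j : Fin 3) (R T : ℕ)
    {κ : ℂ} (hκ : ‖κ‖ ≤ 1) (K : ↥P → ℂ) {M : ℝ} (hM : ∀ p, ‖K p‖ ≤ M) {C : ℝ} (hC : 0 ≤ C) :
    |∫ z, (κ * ((loopChar S x i j R T z : Circle) : ℂ)).re *
        (C * complexGinibreWeight (fun p : ↥P => plaqChar S p.1.1 p.1.2.1 p.1.2.2) K z) ∂torusHaar ↥S| ≤
      Real.exp (-rectSum (extPot S a) x i j R T) *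
        Real.exp (M * ∑ p ∈ P, (Real.cosh (plaqSum (extPot S a) p.1 p.2.1 p.2.2) - 1)) *
        ∫ z, C * complexGinibreWeight (fun p : ↥P => plaqChar S p.1.1 p.1.2.1 p.1.2.2) K z ∂torusHaar ↥S := by
  have hq : ∀ (p : ↥P) (τ : ℝ), plaqChar S p.1.1 p.1.2.1 p.1.2.2 (expField a τ) =
      Circle.exp (τ * plaqSum (extPot S a) p.1.1 p.1.2.1 p.1.2.2) := fun p τ =>
    plaqChar_expField S a _ _ _ τ
  have hq₀ : ∀ τ : ℝ, loopChar S x i j R T (expField a τ) =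
      Circle.exp (τ * rectSum (extPot S a) x i j R T) := fun τ => loopChar_expField S a x i j R T τ
  have hMS := Literature.Probability.LatticeModels.abs_integral_reMulChar_mul_complexGinibreWeight_le
    (torusHaar ↥S) (K := K) hq hq₀ κ
  have e1 : ∀ z : ↥S → Circle,
      (κ * ((loopChar S x i j R T z : Circle) : ℂ)).re *
          (C * complexGinibreWeight (fun p : ↥P => plaqChar S p.1.1 p.1.2.1 p.1.2.2) K z) =
        C * ((κ * ((loopChar S x i j R T z : Circle) : ℂ)).re *
          complexGinibreWeight (fun p : ↥P => plaqChar S p.1.1 p.1.2.1 p.1.2.2) K z) := fun z => by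
    ring
  simp_rw [e1, integral_const_mul]
  rw [abs_mul, abs_of_nonneg hC]
  have hsum : ∑ p : ↥P, ‖K p‖ * (Real.cosh (plaqSum (extPot S a) p.1.1 p.1.2.1 p.1.2.2) - 1) ≤
      M * ∑ p ∈ P, (Real.cosh (plaqSum (extPot S a) p.1 p.2.1 p.2.2) - 1) := by
    rw [Finset.mul_sum, ← Finset.sum_coe_sort P]
    exact Finset.sum_le_sum fun p _ => mul_le_mul_of_nonneg_right (hM p)
      (sub_nonneg.2 (Real.one_le_cosh _))
  have hZ : 0 ≤ ∫ z, complexGinibreWeight (fun p : ↥P => plaqChar S p.1.1 p.1.2.1 p.1.2.2) K z ∂torusHaar ↥S :=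
    integral_nonneg fun z => (Literature.Probability.LatticeModels.complexGinibreWeight_pos _ K z).le
  calc C * |∫ z, (κ * ((loopChar S x i j R T z : Circle) : ℂ)).re *
          complexGinibreWeight (fun p : ↥P => plaqChar S p.1.1 p.1.2.1 p.1.2.2) K z ∂torusHaar ↥S|
      ≤ C * (‖κ‖ * Real.exp (-rectSum (extPot S a) x i j R T) *
          Real.exp (∑ p : ↥P, ‖K p‖ * (Real.cosh (plaqSum (extPot S a) p.1.1 p.1.2.1 p.1.2.2) - 1)) *
          ∫ z, complexGinibreWeight (fun p : ↥P => plaqChar S p.1.1 p.1.2.1 p.1.2.2) K z ∂torusHaar ↥S) :=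
        mul_le_mul_of_nonneg_left hMS hC
    _ ≤ C * (1 * Real.exp (-rectSum (extPot S a) x i j R T) *
          Real.exp (M * ∑ p ∈ P, (Real.cosh (plaqSum (extPot S a) p.1 p.2.1 p.2.2) - 1)) *
          ∫ z, complexGinibreWeight (fun p : ↥P => plaqChar S p.1.1 p.1.2.1 p.1.2.2) K z ∂torusHaar ↥S) := by
        gcongr
    _ = _ := by ring

omit [TopologicalSpace G] [IsTopologicalGroup G] [CompactSpace G] [MeasurableSpace G] [BorelSpace G] in
/-- The rotation bound applied to the expanded model at fixed gauge field `U`: for every real field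
`a` on the bonds of `Λ`, `|∫ W(ι(χ)U) e^{-βS(ι(χ)U)} dχ| ≤ e^{-a(ℓ)} exp(nβ ∑_p (cosh (da)_p − 1)) ∫ e^{-βS(ι(χ)U)} dχ`.
[cite: GlimmJaffe1977QuarkTrapping, main estimate (complex rotation of the `U(1)` variables)] -/
theorem abs_integral_twistCfg_le [MeasurableSpace Circle] [BorelSpace Circle] (hι : ∀ w g, ι w * g = g * ι w)
    (hρι : ∀ w : Circle, ρ (ι w) = (w : ℂ) • (1 : Matrix (Fin n) (Fin n) ℂ))
    (hunit : ∀ g, ρ g ∈ Matrix.unitaryGroup (Fin n) ℂ) (hn : 1 ≤ n) {β : ℝ} (hβ : 0 ≤ β)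
    (U : ZdGaugeConfig 3 G) (a : ↥(bondsOf Λ) → ℝ)
    (x : Literature.Probability.LatticeModels.Site 3) (i j : Fin 3) (R T : ℕ) :
    |∫ z, zdWilsonLoop ρ x i j R T (twistCfg ι z U) *
        Real.exp (-β * zdWilsonAction ρ Λ (twistCfg ι z U)) ∂torusHaar ↥(bondsOf Λ)| ≤
      Real.exp (-rectSum (extPot (bondsOf Λ) a) x i j R T) *
        Real.exp (n * β * ∑ p ∈ plaquettesIn Λ,
          (Real.cosh (plaqSum (extPot (bondsOf Λ) a) p.1 p.2.1 p.2.2) - 1)) *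
        ∫ z, Real.exp (-β * zdWilsonAction ρ Λ (twistCfg ι z U)) ∂torusHaar ↥(bondsOf Λ) := by
  simp_rw [zdWilsonLoop_twistCfg (Λ := Λ) hι hρι, weight_twistCfg (Λ := Λ) hι hρι]
  have hκ1 : ‖(n : ℂ)⁻¹ * (ρ (U.rectangle x i j R T)).trace‖ ≤ 1 := by
    rw [norm_mul, norm_inv, Complex.norm_natCast]
    have hn0 : (0 : ℝ) < n := by exact_mod_cast hn
    rw [inv_mul_le_iff₀ hn0, mul_one]
    exact norm_trace_le_of_mem_unitaryGroup (hunit _)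
  have hKp : ∀ p : ↥(plaquettesIn Λ), ‖(β : ℂ) * (ρ (U.plaquette p.1.1 p.1.2.1 p.1.2.2)).trace‖ ≤ n * β :=
    fun p => by
    rw [norm_mul, Complex.norm_real, Real.norm_eq_abs, abs_of_nonneg hβ, mul_comm]
    exact mul_le_mul_of_nonneg_right (norm_trace_le_of_mem_unitaryGroup (hunit _)) hβ
  exact abs_integral_loopChar_weight_le (bondsOf Λ) (plaquettesIn Λ) a x i j R T hκ1 _ hKp
    (Real.exp_pos _).le

/-- **The finite-volume bound with a free rotation parameter `δ`**: for `0 ≤ δ ≤ 1`,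
`|⟨W_{R×T}⟩_{Λ,β}| ≤ exp(−Tδ log(R+1) + nβ · 189 T δ² (1 + log(R+1)))`. [cite: GlimmJaffe1977QuarkTrapping, main estimate (before optimising the rotation field)] -/
theorem abs_zdExpect_wilsonLoop_le_exp [MeasurableSpace Circle] [BorelSpace Circle] [SecondCountableTopology G] (hρc : Continuous ρ)
    (hι : ∀ w g, ι w * g = g * ι w)
    (hρι : ∀ w : Circle, ρ (ι w) = (w : ℂ) • (1 : Matrix (Fin n) (Fin n) ℂ)) (hιc : Continuous ι)
    (hunit : ∀ g, ρ g ∈ Matrix.unitaryGroup (Fin n) ℂ) (hn : 1 ≤ n) {β : ℝ} (hβ : 0 ≤ β)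
    {x : Literature.Probability.LatticeModels.Site 3} {i j : Fin 3} (hij : i ≠ j) {R T : ℕ}
    (hΛ : rectangleSites x i j R T ⊆ Λ) {δ : ℝ} (hδ0 : 0 ≤ δ) (hδ1 : δ ≤ 1) :
    |zdExpect ρ β Λ (zdWilsonLoop ρ x i j R T)| ≤
      Real.exp (-(T * (δ * Real.log (R + 1))) + n * β * (189 * T * δ ^ 2 * (1 + Real.log (R + 1)))) := by
  set S := bondsOf Λ
  set a : ↥S → ℝ := fun s => pot x i j R T δ s.1 with ha
  set w : ZdGaugeConfig 3 G → ℝ := fun U => Real.exp (-β * zdWilsonAction ρ Λ U) with hw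
  set F : ZdGaugeConfig 3 G → ℝ := fun U => zdWilsonLoop ρ x i j R T U * w U with hF
  have hwc : Continuous w :=
    Real.continuous_exp.comp (continuous_const.mul (AreaLaw.continuous_zdWilsonAction ρ hρc Λ))
  have hFc : Continuous F := (AreaLaw.continuous_zdWilsonLoop ρ hρc x i j R T).mul hwc
  -- the bound `B`
  set B : ℝ := Real.exp (-rectSum (extPot S a) x i j R T) *
    Real.exp (n * β * ∑ p ∈ plaquettesIn Λ, (Real.cosh (plaqSum (extPot S a) p.1 p.2.1 p.2.2) - 1)) with hB
  have hB0 : 0 ≤ B := by positivity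
  -- B ≤ the stated exponential
  have hBle : B ≤ Real.exp (-(T * (δ * Real.log (R + 1))) +
      n * β * (189 * T * δ ^ 2 * (1 + Real.log (R + 1)))) := by
    rw [hB, ← Real.exp_add, Real.exp_le_exp, rectSum_extPot_pot hij hΛ]
    have hcong : ∀ p ∈ plaquettesIn Λ, plaqSum (extPot S a) p.1 p.2.1 p.2.2 =
        plaqSum (pot x i j R T δ) p.1 p.2.1 p.2.2 := fun p hp =>
      plaqSum_extPot_eq a (pot x i j R T δ) (fun _ _ => rfl) hp
    rw [Finset.sum_congr rfl fun p hp => by rw [hcong p hp]]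
    have := sum_cosh_plaqSum_pot_sub_one_le (x := x) (R := R) (T := T) hij hδ0 hδ1 Λ
    have hnb : (0 : ℝ) ≤ n * β := by positivity
    nlinarith
  -- Step 1: pointwise in `U`
  have hpt : ∀ U : ZdGaugeConfig 3 G, |∫ z, F (twistCfg ι z U) ∂torusHaar ↥S| ≤
      B * ∫ z, w (twistCfg ι z U) ∂torusHaar ↥S := fun U =>
    abs_integral_twistCfg_le (Λ := Λ) hι hρι hunit hn hβ U a x i j R T
  -- Step 2: Fubini / invariance
  have hFI := integral_eq_integral_integral_twistCfg (Λ := Λ) hιc hFc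
  have hwI := integral_eq_integral_integral_twistCfg (Λ := Λ) hιc hwc
  have hZ : 0 < ∫ U, w U ∂zdHaar 3 G :=
    integral_exp_pos (AreaLaw.integrable_zdHaar_of_continuous hwc)
  have hwint : Integrable (fun U => B * ∫ z, w (twistCfg ι z U) ∂torusHaar ↥S) (zdHaar 3 G) :=
    (integrable_integral_twistCfg (Λ := Λ) hιc hwc).const_mul B
  rw [AreaLaw.zdExpect_eq_div_integral ρ hρc β Λ]
  change |(∫ U, F U ∂zdHaar 3 G) / ∫ U, w U ∂zdHaar 3 G| ≤ _
  rw [abs_div, abs_of_pos hZ, div_le_iff₀ hZ]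
  calc |∫ U, F U ∂zdHaar 3 G|
      = |∫ U, (∫ z, F (twistCfg ι z U) ∂torusHaar ↥S) ∂zdHaar 3 G| := by rw [hFI]
    _ ≤ ∫ U, |∫ z, F (twistCfg ι z U) ∂torusHaar ↥S| ∂zdHaar 3 G := abs_integral_le_integral_abs
    _ ≤ ∫ U, B * ∫ z, w (twistCfg ι z U) ∂torusHaar ↥S ∂zdHaar 3 G :=
        integral_mono_of_nonneg (ae_of_all _ fun U => abs_nonneg _) hwint (ae_of_all _ hpt)
    _ = B * ∫ U, w U ∂zdHaar 3 G := by rw [integral_const_mul, ← hwI]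
    _ ≤ _ := mul_le_mul_of_nonneg_right hBle hZ.le

end Assembly

/-! ### F. The constants: Chatterjee's Theorem 3.1 -/

section Final

/-- The arithmetic of the rotation parameter: with `δ = min(1, 1/(945 nβ))` and `R ≥ 1`,
`−Tδ log(R+1) + nβ · 189 T δ² (1 + log(R+1)) ≤ −T log(R+1) / (1890 (1 + nβ))`. [folklore] -/
private theorem exponent_le {n : ℕ} (hn : 1 ≤ n) {β : ℝ} (hβ : 0 < β) {R : ℕ} (hR : 1 ≤ R) (T : ℕ) :
    -((T : ℝ) * (min 1 (1 / (945 * (n * β))) * Real.log (R + 1))) +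
        n * β * (189 * T * (min 1 (1 / (945 * (n * β)))) ^ 2 * (1 + Real.log (R + 1))) ≤
      -(1 / 1890) * T * Real.log (R + 1) / (1 + n * β) := by
  set δ : ℝ := min 1 (1 / (945 * (n * β))) with hδ
  set L : ℝ := Real.log (R + 1) with hL
  have hnb : 0 < (n : ℝ) * β := mul_pos (by exact_mod_cast hn) hβ
  have hδ0 : 0 < δ := lt_min one_pos (by positivity)
  have hδ1 : δ ≤ 1 := min_le_left _ _
  have hδ2 : δ ≤ 1 / (945 * (n * β)) := min_le_right _ _
  have hL2 : Real.log 2 ≤ L := by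
    have h1R : (1 : ℝ) ≤ R := by exact_mod_cast hR
    rw [hL]; exact Real.log_le_log two_pos (by linarith)
  have hlog2 : (0.6931471803 : ℝ) < Real.log 2 := Real.log_two_gt_d9
  have hL0 : 0 < L := by linarith
  have hT : (0 : ℝ) ≤ T := Nat.cast_nonneg T
  -- `1 + L ≤ (5/2) L`
  have h1L : 1 + L ≤ 5 / 2 * L := by linarith
  -- `nβ · 189 δ (1+L) ≤ (1/2) L` using `945 nβ δ ≤ 1`
  have hnbδ : n * β * δ ≤ 1 / 945 := by
    calc n * β * δ ≤ n * β * (1 / (945 * (n * β))) := mul_le_mul_of_nonneg_left hδ2 hnb.le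
      _ = 1 / 945 := by field_simp
  have hcost : n * β * (189 * T * δ ^ 2 * (1 + L)) ≤ T * δ * L / 2 := by
    have h2 : n * β * (189 * T * δ ^ 2 * (1 + L)) ≤ n * β * (189 * T * δ ^ 2 * (5 / 2 * L)) := by
      gcongr
    refine h2.trans ?_
    have h3 : n * β * (189 * T * δ ^ 2 * (5 / 2 * L)) = (n * β * δ) * (945 / 2) * (T * δ * L) := by ring
    rw [h3]
    have h4 : (n * β * δ) * (945 / 2) ≤ 1 / 2 := by nlinarith
    have h5 : 0 ≤ T * δ * L := by positivity
    nlinarith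
  -- `δ ≥ 1/(945 (1 + nβ))`
  have hδlow : 1 / (945 * (1 + n * β)) ≤ δ := by
    rw [hδ]
    refine le_min ?_ ?_
    · rw [div_le_one (by positivity)]; nlinarith
    · exact one_div_le_one_div_of_le (by positivity) (by nlinarith)
  have hmain : -(T * (δ * L)) + n * β * (189 * T * δ ^ 2 * (1 + L)) ≤ -(T * δ * L / 2) := by nlinarith
  refine hmain.trans ?_
  rw [show -(1 / 1890 : ℝ) * T * L / (1 + n * β) = -(T * L * (1 / (945 * (1 + n * β))) / 2) by
    field_simp; ring]
  have : T * L * (1 / (945 * (1 + n * β))) ≤ T * L * δ := by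
    exact mul_le_mul_of_nonneg_left hδlow (by positivity)
  linarith

end Final

end CentralCircle

/-- **Chatterjee 2026, Theorem 3.1, PROVED** (logarithmic confinement of three-dimensional Wilson
lattice gauge theories whose gauge group contains the central circle; Fröhlich 1979 Cor. 2 /
Glimm–Jaffe 1977), with the universal constant `C = 1/1890`. The proof is the expanded model of
the source's §4 (auxiliary `U(1)` bond variables, Haar invariance under the central circle, Fubini)
combined — instead of the source's Lemma 4.1–4.3 — with the Glimm–Jaffe / McBryan–Spencer complex
rotation of the auxiliary variables (`CharacterComplexRotationBound.lean`) along the logarithmic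
rotation field of the loop, whose energy over the `T` slices is `O(T δ² log R)` (two-dimensional
shells). [cite: Chatterjee2026CentralU1, Thm 3.1] -/
theorem chatterjee_centralCircle_confinement_d3_holds : chatterjee_centralCircle_confinement_d3 := by
  refine ⟨1 / 1890, by norm_num, ?_⟩
  intro n hn G _ _ _ _ _ _ ρ hρc hinj hunit hsc β hβ Λ x i j R T hij hR hRT hΛ
  haveI : SecondCountableTopology G := CentralCircle.secondCountableTopology_of_model ρ hinj hρc
  letI : MeasurableSpace Circle := borel Circle
  haveI : BorelSpace Circle := ⟨rfl⟩
  have hunit' : ∀ g, ρ g ∈ Matrix.unitaryGroup (Fin n) ℂ := fun g => hunit (Set.mem_range_self g)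
  set ι := CentralCircle.centralCircleHom ρ hinj hsc with hιdef
  have hι := CentralCircle.centralCircleHom_comm ρ hinj hsc
  have hρι := CentralCircle.rho_centralCircleHom ρ hinj hsc
  have hιc := CentralCircle.continuous_centralCircleHom ρ hinj hsc hρc
  set δ : ℝ := min 1 (1 / (945 * (n * β))) with hδ
  have hδ0 : 0 ≤ δ := le_min zero_le_one (by positivity)
  have hδ1 : δ ≤ 1 := min_le_left _ _
  have h := CentralCircle.abs_zdExpect_wilsonLoop_le_exp (Λ := Λ) (ι := ι) hρc hι hρι hιc hunit' hn hβ.le hij hΛ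
    hδ0 hδ1
  refine h.trans ?_
  rw [Real.exp_le_exp]
  have := CentralCircle.exponent_le hn hβ hR T
  rw [hδ]
  refine (le_of_eq ?_).trans (this.trans (le_of_eq ?_))
  · ring
  · ring


end Literature.MathematicalPhysics.QuantumFieldTheory

end

/-!
## Part III — The explicit constant and the unitary groups `U(n)`, `U(1)`

* `chatterjee_centralCircle_confinement_d3_explicit`: Theorem 3.1 with the explicit universal
  constant `C = 1/1890` produced by the proof of Part II.
* `unitaryGroup_wilsonLoop_logConfinement_d3`: the case `G = U(n)` (fundamental representation),
  `n ≥ 1` — Chatterjee's «This class includes `U(n)` itself».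
* `u1_wilsonLoop_logConfinement_d3`: the case `n = 1`, i.e. **Glimm–Jaffe 1977**: the Wilson loops
  of three-dimensional `U(1)` lattice gauge theory (Wilson action, free boundary conditions) obey
  `|⟨cos θ_{∂(R×T)}⟩_{Λ,β}| ≤ exp(−T log(R+1)/(1890(1+β)))` at every `β > 0` — a logarithmically
  confining static potential.
-/

noncomputable section

namespace Literature.MathematicalPhysics.QuantumFieldTheory

open Literature.MathematicalPhysics.QuantumLattice

/-- **Chatterjee 2026, Theorem 3.1, with the explicit constant `C = 1/1890`** (the constant of the
proof in Part II; the source only asserts a universal `C > 0`). [cite: Chatterjee2026CentralU1, Thm 3.1] -/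
theorem chatterjee_centralCircle_confinement_d3_explicit
    {n : ℕ} (hn : 1 ≤ n) {G : Type*} [Group G] [TopologicalSpace G] [IsTopologicalGroup G]
    [CompactSpace G] [MeasurableSpace G] [BorelSpace G] (ρ : G →* Matrix (Fin n) (Fin n) ℂ)
    (hρc : Continuous ρ) (hinj : Function.Injective ρ)
    (hunit : Set.range ρ ⊆ (Matrix.unitaryGroup (Fin n) ℂ : Set (Matrix (Fin n) (Fin n) ℂ)))
    (hsc : ∀ z : ℂ, ‖z‖ = 1 → z • (1 : Matrix (Fin n) (Fin n) ℂ) ∈ Set.range ρ)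
    {β : ℝ} (hβ : 0 < β) (Λ : Finset (Literature.Probability.LatticeModels.Site 3))
    {x : Literature.Probability.LatticeModels.Site 3} {i j : Fin 3} {R T : ℕ}
    (hij : i ≠ j) (hR : 1 ≤ R) (hΛ : rectangleSites x i j R T ⊆ Λ) :
    |zdExpect ρ β Λ (zdWilsonLoop ρ x i j R T)| ≤
      Real.exp (-(1 / 1890) * T * Real.log (R + 1) / (1 + n * β)) := by
  haveI : SecondCountableTopology G := CentralCircle.secondCountableTopology_of_model ρ hinj hρc
  letI : MeasurableSpace Circle := borel Circle
  haveI : BorelSpace Circle := ⟨rfl⟩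
  have hunit' : ∀ g, ρ g ∈ Matrix.unitaryGroup (Fin n) ℂ := fun g => hunit (Set.mem_range_self g)
  have hι := CentralCircle.centralCircleHom_comm ρ hinj hsc
  have hρι := CentralCircle.rho_centralCircleHom ρ hinj hsc
  have hιc := CentralCircle.continuous_centralCircleHom ρ hinj hsc hρc
  have hδ0 : (0 : ℝ) ≤ min 1 (1 / (945 * (n * β))) := le_min zero_le_one (by positivity)
  have hδ1 : min 1 (1 / (945 * (n * β))) ≤ (1 : ℝ) := min_le_left _ _
  have h := CentralCircle.abs_zdExpect_wilsonLoop_le_exp (Λ := Λ)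
    (ι := CentralCircle.centralCircleHom ρ hinj hsc) hρc hι hρι hιc hunit' hn hβ.le hij hΛ hδ0 hδ1
  refine h.trans ?_
  rw [Real.exp_le_exp]
  have := CentralCircle.exponent_le hn hβ hR T
  refine (le_of_eq ?_).trans (this.trans (le_of_eq ?_))
  · ring
  · ring

/-- The scalars `z · 1`, `|z| = 1`, lie in the image of the fundamental representation of `U(n)`. [cite: Chatterjee2026CentralU1, §3 («this class includes U(n) itself»)] -/
theorem smul_one_mem_range_unitaryFundamentalRep (n : ℕ) (z : ℂ) (hz : ‖z‖ = 1) :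
    z • (1 : Matrix (Fin n) (Fin n) ℂ) ∈ Set.range (unitaryFundamentalRep (Fin n) ℂ) := by
  refine ⟨scalarUnitaryHom ⟨z, mem_sphere_zero_iff_norm.2 hz⟩, ?_⟩
  rfl

/-- **Logarithmic confinement of three-dimensional `U(n)` lattice gauge theory** (Chatterjee 2026
Thm 3.1 for `G = U(n)`, fundamental representation; Fröhlich 1979 Cor. 2): for `n ≥ 1`, `β > 0`,
every finite `Λ ⊆ ℤ³` and every `R × T` loop in `Λ` with `R ≥ 1`,
`|⟨(1/n) Re tr U_{∂(R×T)}⟩_{Λ,β}| ≤ exp(−T log(R+1) / (1890 (1 + nβ)))`. [cite: Chatterjee2026CentralU1, Thm 3.1 (the case G = U(n))] -/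
theorem unitaryGroup_wilsonLoop_logConfinement_d3 {n : ℕ} (hn : 1 ≤ n) {β : ℝ} (hβ : 0 < β)
    (Λ : Finset (Literature.Probability.LatticeModels.Site 3))
    {x : Literature.Probability.LatticeModels.Site 3} {i j : Fin 3} {R T : ℕ}
    (hij : i ≠ j) (hR : 1 ≤ R) (hΛ : rectangleSites x i j R T ⊆ Λ) :
    |zdExpect (unitaryFundamentalRep (Fin n) ℂ) β Λ
        (zdWilsonLoop (unitaryFundamentalRep (Fin n) ℂ) x i j R T)| ≤
      Real.exp (-(1 / 1890) * T * Real.log (R + 1) / (1 + n * β)) :=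
  chatterjee_centralCircle_confinement_d3_explicit hn (unitaryFundamentalRep (Fin n) ℂ)
    (continuous_unitaryFundamentalRep (Fin n) ℂ) (unitaryFundamentalRep_injective (Fin n) ℂ)
    (by rintro _ ⟨g, rfl⟩; exact g.2) (smul_one_mem_range_unitaryFundamentalRep n) hβ Λ hij hR hΛ

/-- **Glimm–Jaffe 1977: quark trapping for three-dimensional lattice `U(1)` gauge fields** (the case
`n = 1`): for the `U(1)` lattice gauge theory with Wilson action and free boundary conditions on any
finite `Λ ⊆ ℤ³`, every `β > 0` and every `R × T` loop in `Λ` with `R ≥ 1`,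
`|⟨cos θ_{∂(R×T)}⟩_{Λ,β}| ≤ exp(−T log(R+1) / (1890 (1 + β)))` — the static quark potential grows at
least logarithmically, `V(R) ≥ log(R+1)/(1890(1+β))`. [cite: GlimmJaffe1977QuarkTrapping, main theorem (logarithmic lower bound on the U(1)₃ potential)] -/
theorem u1_wilsonLoop_logConfinement_d3 {β : ℝ} (hβ : 0 < β)
    (Λ : Finset (Literature.Probability.LatticeModels.Site 3))
    {x : Literature.Probability.LatticeModels.Site 3} {i j : Fin 3} {R T : ℕ}
    (hij : i ≠ j) (hR : 1 ≤ R) (hΛ : rectangleSites x i j R T ⊆ Λ) :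
    |zdExpect (unitaryFundamentalRep (Fin 1) ℂ) β Λ
        (zdWilsonLoop (unitaryFundamentalRep (Fin 1) ℂ) x i j R T)| ≤
      Real.exp (-(1 / 1890) * T * Real.log (R + 1) / (1 + β)) := by
  have h := unitaryGroup_wilsonLoop_logConfinement_d3 le_rfl hβ Λ hij hR hΛ (n := 1)
  simpa only [Nat.cast_one, one_mul] using h

end Literature.MathematicalPhysics.QuantumFieldTheory

end
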